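import Mathlib
import Literature.MathematicalPhysics.QuantumFieldTheory.Balaban1983to89.B15LatticeCubeContours
import Literature.MathematicalPhysics.QuantumFieldTheory.Balaban1983to89.B15LatticeCubeTorus

/-!
# `Balaban1983to89.B6Lemma21PrintedDomains` — [Balaban1984PropagatorsII] LEMMA 2.1 (2.60)–(2.63) WITH THE d-ONLY CONSTANT
# c₁″ = 13c₀(½α)^{4d} IN THE PAPER'S OWN SETTING (2.1)–(2.4) p. 224: a nested sequence of cube domains
# T = Ω₀ ⊃ Ω₁ ⊃ … ⊃ Ω_k on ℤᵈ, each Ω_j a union of LʲM-cubes, separated by the collar (2.2) «(Lʲη)⁻¹ dist(Ω_jᶜ, Ω_{j+1}) > RM»,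
# with print's distance (2.46) read literally (R0) on print's generating set 𝔅 = ⋃_j Λ_j — the walk form of (2.57) WITH
# PRINT'S RM, the existence of admissible contours, (2.60) with print's RM in the exponent, and (2.61″)–(2.63″) under (2.59)

statement-level skeleton of published theorems with citation tags; proofs where landed; nothing here is a claim about the Yang–Mills mass gap

CITATION HEADER (lean-in-tree rule 2026-08-18).  Source: T. Bałaban, *Propagators and renormalization transformations for
lattice gauge theories. II*, Commun. Math. Phys. **96**, 223–250 (1984), doi:10.1007/bf01240221 [Balaban1984PropagatorsII]
(cell paper B6; PDF held `paper:balaban1984-cmp96-propagators-rt-ii`, journal page = PDF page + 222; p. 224 [PDF 2] re-read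
this generation from the text layer, pp. 231–234 [PDF 9–12] as quoted verbatim in the headers of the imported siblings).
WHAT IS REPRODUCED: lit-balaban SKELETON rows **B6.Lem2.1** (Lemma 2.1 (2.60)–(2.63) p. 234), **B6.Eq2.56** ((2.57) p. 233,
walk form), **B6.Eq2.45** ((2.46) p. 231, reading R0 of HOME/GAPS.md G-B6-22), and the setting (2.1)–(2.4) p. 224 — cells
only, heads unchanged (the printed c₁(α) = 12c₀(½α)^d stays refuted as typed, G-A11-1 / G-B6-01a/b/c).  Unit
`lit-balaban-p29` (Phase-2 proof seat p29, gen 15), HOME `run/shared/lean/pub/lit-balaban/`; B6 fold owner r03, referee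
ref-4; closes B6-CLOSURE §3.7 (iv) «print's full generality» on ℤᵈ (the universal cover of T_η).  IMPORTS, NOT MODIFIED:
`…B15LatticeCubeContours` (p29 gen 12: the lattice contour graph `latC` of reading R0 on the cube-sites of the ℤᵈ model,
`LatStep`, `sideZ`, `cornerC`, `latC_adj`, `latC_adj_of_idx_succ`, `reachable_in_box`, `site_eq_of_mem`, `cornerC_injective`,
the two-sided drawing `latDrawing`, `latSystem`, `latGeo`, `realizes_latGeo`; through it `…B15Ineq147LevelGap` (r12: `toR`,
`cube`, `corner`, `CubeSite`, `zoneC`, `LayerSepZd`), `…B15TouchingCubeContours` (`Tiles`, `mem_cube_iff_cubeIdx`,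
`tiles_of_layers`, `cover_of_exhaustive`, `layers_of_partitions`), `…B14DomainGeom` (pv02/r11: `cubeIdx`, `IsUnionOfCubes`),
`…B6Decomp247LatticeTwoSided` (`lemma21_full_of_twoSidedDrawing`, `ineq261T_of_twoSidedDrawing`), `…B6Geometry`
(`Separates`, `LevelGap`, `separates_of_levelGap`), `…B6`, `…B6RandomWalk`, `…B6Lemma21Repaired`, `…B6Lemma21TwoScale`).
Nothing is restated.

THE PRINTED TEXT.  p. 224 [PDF 2], verbatim: *"We consider a sequence of domains Ω₁ ⊃ Ω₂ ⊃ … ⊃ Ω_k, Ω_j ⊂ T_η,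
j = 1, 2, …, k, (2.1) which satisfy the following conditions: Ω_j = B^j(Ω_j^{(j)}), Ω_j^{(j)} ⊂ T^{(j)}_{L^jη} and it is a sum
of big blocks, (L^jη)^{−1} dist(Ω_j^c, Ω_{j+1}) > RM, M is a size of big blocks and R is a big positive integer which will be
fixed later. (2.2) … Let us define Λ_j = Ω_j^{(j)}∖Ω_{j+1}^{(j)}, j = 1, …, k − 1, Λ_k = Ω_k^{(k)}, Λ₀ = Ω₁^c (2.3) … thus we
have Ω₁ = ⋃_{j=1}^k B^j(Λ_j), T = ⋃_{j=0}^k B^j(Λ_j), where B⁰(Λ₀) = Λ₀. (2.4) Let us notice that we admit the case when some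
domains Ω_j are equal to T_η, for example Ω_j = T_η for j = 1, 2, …, l, l ≤ k."*  p. 231 [PDF 9]: *"𝔅 = ⋃_{j=0}^k Λ_j. (2.45)
… We consider a special class of contours Γ. They have the property that a part of Γ contained in B^j(Λ_j) consists of bonds
of the lattice Λ_j. Now we define d(y, y′) = inf_{Γ_{y,y′}} Σ_{j=0}^k (L^jη)^{−1}|Γ_{y,y′} ∩ B^j(Λ_j)|, y, y′ ∈ 𝔅, (2.46) … Of
course the infimum is attained at some contour Γ_{y,y′}."*  p. 233 [PDF 11]: *"From the condition (2.2) and from the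
definition of the points y′_l, y_{l+1}, more exactly from the fact that they belong to different surfaces Σ_j, we have
(L^{j_{l,l+1}}η)^{−1}|y′_l − y_{l+1}| > RM. (2.57)"*; *"Now we require that RM is sufficiently large, i.e. we assume
¼αδ₀RM > 2d log c₀(½α) + 1. (2.59)"*.  p. 234 [PDF 12], Lemma 2.1: *"For the numbers α, 0 < α < 1, c₁(α) = 12c₀^d(½α), and
RM satisfying (2.59) we have e^{−αδ₀d(y,y′)} ≤ e^{−αδ₀RM max{|j−j′|−1,0}}, y ∈ Λ_j, y′ ∈ Λ_{j′}, (2.60) sup_{y∈𝔅} Σ_{y′∈𝔅}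
e^{−αδ₀d(y,y′)} ≤ c₁(α), (2.61)"* and (2.62), (2.63).

THE POINT.  The tree derives Lemma 2.1 with a constant depending on d, δ₀, α only (c₁″; never the printed c₁(α), refuted as
typed) for print's literal distance on the ℤᵈ cube carrier in TWO instances: the [III]/[IV] (2.13)-admissible sequences
(`B15LatticeCubeContours.lemma21_full_latGeo_admissible`: collar = ONE CUBE OF THE NEXT SCALE, L^{j+1}M, and print's RM
replaced by the collar count M/M₁ ≤ collar/L in (2.59)/(2.60)) and the nested boxes.  The paper's own hypothesis is weaker
and its conclusion sharper: (2.2) asks only for a collar of RM bonds of Λ_j — thinner than one Ω_{j+1}-cube whenever R < L,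
R being *"a big positive integer"* fixed by (2.59) independently of L — and (2.57)/(2.60) carry THAT RM.  THIS FILE proves
Lemma 2.1 in exactly this generality (B6-CLOSURE §3.7 (iv), last clause, on the universal cover ℤᵈ of T_η).  §1 the ℓ¹
(lattice-contour) form of (2.2) on the carrier: `SepZd Z M₁ L N` — a point of `Z_n` (= Ω_nᶜ) and a point outside `Z_{n+1}`
(= of Ω_{n+1}) are more than `N` sides of a scale-n cube apart in the ℓ¹ norm `l1Dist` of ℤᵈ (the WEAKEST reading: implied by
the sup-norm and by the Euclidean reading with the same threshold, `sepZd_of_sup`, `sepZd_of_eucl`, and by the [III] collar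
`LayerSepZd Z M L` for every `N` with `N·M₁ < M·L`, `sepZd_of_layerSepZd`).  §2 THE WALK FORM OF (2.57) WITH PRINT'S RM:
`levelGap_latC_of_sepZd : SepZd Z M₁ L N → LevelGap (latC M₁ L Z) zoneC N` — a chain of lattice bonds from a cube of
scale < i to a cube of scale > i has at least N + 1 bonds.  Proof = print's (2.48)/(2.57) on the corners: every bond of the
chain up to the first cube b of scale > i is an axis move by the side of a cube of scale ≤ i (ℓ¹-length ≤ M₁Lⁱ), except
possibly the LAST one, which in reading R0 may be a bond of the coarser lattice Λ_{i+1} along an edge of b ending at the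
corner of the previous (finer) cube — but then that corner is at ℓ¹-distance 1 from a lattice point of b
(`exists_near_of_adj`); so a point of Z_i (the first corner) and a point of the cube b ⊄ Z_{i+1} are within (number of
bonds)·M₁Lⁱ in ℓ¹ (`exists_point_of_walk`), and (2.2) gives the count.  `Separates` follows for N ≥ 1.  §3 THE ADMISSIBLE
CONTOURS EXIST (print: *"Of course the infimum is attained"*): `latC_connected_of_sepZd` under `SepZd Z M₁ L N`, `N ≥ 1`,
the covering (2.4) `Tiles`, `M₁ ≥ 1`, `L ≥ 2` — the proof of `B15LatticeCubeContours.latC_connected` line by line (unit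
steps between lattice points; same scale / into a coarser cube along its −e_μ face / into a finer cube by the Λ_{n+1}-bond
along the +e_μ edge), with the ONE place where that file used the [III] collar — step (i) of the slab lemma: a point within
one scale-n side of a scale-(n+1) cube is not in Z_n — now fed by the ℓ¹ collar with N ≥ 1 (`layer_of_near_sepZd`), and the
scale comparison of face-adjacent cubes likewise (`zone_le_succ_of_unitStep`).  §4 LEMMA 2.1 (2.60)–(2.63) with c₁″ for
every geometry realised by these contours (`ineq261T_latC_of_sepZd`, embedded form; `lemma21_full_latGeo_of_sepZd`, the
named geometry `latGeo`) from `B6Decomp247LatticeTwoSided.lemma21_full_of_twoSidedDrawing` on `latDrawing`, with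
`R·M_r ≤ N`, `2 ≤ N`.  §5 THE PAPER'S SETTING VERBATIM: `Cond22 Ω L RM` = (2.2) in ℓ¹ on an antitone `Ω : ℕ → Set ℤᵈ` with
`Ω 0 = T` (so that Λ₀ = Ω₁ᶜ has zone 0, (2.3)–(2.4)), `Ω (k+1) = ∅` (k levels, Λ_k = Ω_k^{(k)}), every `Ω j` a union of
`LʲM`-cubes ((2.1) *"a sum of big blocks"*); sites = `CubeSite 1 L Ωᶜ` = the base points y of the blocks B^j(y),
y ∈ Λ_j, i.e. PRINT'S 𝔅 LITERALLY; **`lemma21_printedDomains`**: for `2 ≤ R·M`, `2 ≤ L`, `δ₀ > 0`, every finite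
set of sites, every 0 < α < 1 with (2.59) FOR PRINT'S R, M: (2.60) with e^{−αδ₀RM max{|j−j′|−1,0}} ∧ (2.61″) ∧ (2.62″) ∧
(2.63″) with c₁″; plus `levelGap_printedDomains` ((2.57): LevelGap (R·M)), `connected_printedDomains`,
`separates_printedDomains`, and the sup-norm / Euclidean readings of «dist» in (2.2) as corollaries
(`lemma21_printedDomains_sup`, `lemma21_printedDomains_eucl`), and the FAMILY form `B6Lemma21TwoScale.Lemma21TwoScale` — ONE
d-only constant uniformly over any family of such domain data, the shape `DagBinding.b6Lemma21Param_of_twoScale` consumes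
(`lemma21TwoScale_latGeo_sepZd_family`, `lemma21TwoScale_printedDomains_family`).  §6 A WITNESS WITH R < L (d = 1, L = 8, M = 1, R = 3:
Ω₁ = {x ≥ −32}, Ω₂ = {x ≥ 0}, Ω₃ = ∅): (2.1)–(2.2) hold, the [III] one-cube collar `LayerSepZd` FAILS for every M′ ≥ 1
(`not_layerSepZd_witness`), all three scales occur, and `lemma21_printedDomains` applies (`lemma21_witness`) — the new
generality is inhabited and is not covered by the admissible-sequence instance.

WHAT IS PROVED (kernel-checked; no `sorry`; axioms ⊆ {propext, Classical.choice, Quot.sound}; new definitions with bodies: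
`l1Dist`, `toE`, `SepZd`, `Cond22`, `Cond22Sup`, `Cond22Eucl`, the §6 witness `ΩW`/`siteW₀`/`siteW₁`/`siteW₂`/`FW`; 0 new `structure`s, 0 new
`def … : Prop` facts — `SepZd`/`Cond22*` are HYPOTHESIS SHAPES (print's (2.2)), used only to the left of `→`).  Main
declarations: `sepZd_of_sup`, `sepZd_of_eucl`, `sepZd_of_layerSepZd`, `levelGap_latC_of_sepZd`, `separates_latC_of_sepZd`,
`layer_of_near_sepZd`, `latC_connected_of_sepZd`, `ineq261T_latC_of_sepZd`, `lemma21_full_latGeo_of_sepZd`,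
`levelGap_printedDomains`, `connected_printedDomains`, `lemma21_printedDomains`, `lemma21_printedDomains_sup`,
`lemma21_printedDomains_eucl`, `lemma21TwoScale_printedDomains_family`, `not_layerSepZd_witness`, `lemma21_witness`.
v1.1 (APPEND-ONLY §7–§8, one new import `…B15LatticeCubeTorus`; every v1 declaration unchanged): THE SAME ON THE TORUS
T_η = ℤᵈ/∏_μ P_μℤ (print's *«Ω_j ⊂ T_η»*, wrap-around contours) by the lineage's universal-cover transfer (p29 gen 13:
`torC`, `torGeo`, `exists_lift_dist_eq`, `eq_of_shift_eq`, `levelGap_torC`, `torC_connected`, `isPeriodic_of_top` BY NAME):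
`ineq260_torGeo_of_sepZd`, `triangle254_torGeo_of_sepZd`, `ineq261T_torGeo_of_sepZd`, `lemma21TwoScale_torGeo_of_sepZd`,
`lemma21_full_torGeo_of_sepZd` (§7: periodic nested `Z` with the ℓ¹ collar on the cover); §8 print's torus setting:
`isPeriodic_printedDomains`, **`lemma21_printedDomains_torus`** (periodic nested LʲM-cube domains, `L^k ∣ P_μ`, the collar
(2.2) — Lemma 2.1 (2.60)–(2.63) with c₁″ and print's RM for the TORUS geometry `torGeo`), and a 1600-periodic witness with
R = 3 < L = 8 (`ΩT`, `cond22_ΩT`, `lemma21_witness_torus`).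

TYPING ∕ DIVERGENCE (honest).  (a) «dist» in (2.2) and |y − y′| in (2.48)/(2.57) are not given a norm in print; the lattice
contours of (2.46) are chains of axis-parallel bonds, so the argument (2.48) («the length of a contour dominates the distance
of its end-points») holds for every norm in which a unit lattice step has length 1 — we take the ℓ¹ norm on ℤᵈ ≅ η⁻¹T_η as
the PRIMARY hypothesis (the weakest: ‖·‖₁ ≥ ‖·‖₂ ≥ ‖·‖_∞, so (2.2) read with the Euclidean or the sup norm implies the ℓ¹
reading with the same RM; both readings are served as corollaries).  (b) THE CARRIER is ℤᵈ with η = 1 (scale-invariant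
statements; the torus T_η = its quotient is treated in §7–§8 (v1.1) by the lineage's universal-cover transfer
`B15LatticeCubeTorus` for periodic data), scales counted upward from the unit lattice (zone j =
print's j, Λ₀ = Ω₁ᶜ the unit-lattice points outside Ω₁), `Z_j := Ω_jᶜ` increasing, `Ω 0 := T`.  (c) INTEGRALITY: R and M
are positive integers in print (*"R is a big positive integer"*, M the linear size of a big block in lattice units); the walk
form needs `N = R·M ∈ ℕ`; the two-sided reconstruction of `B6Decomp247LatticeTwoSided` needs `2 ≤ R·M` (its TYPING (c);
print's regime (2.59) with M large).  (d) CONSTANT: c₁″ = 13c₀(½α)^{4d} (`B6Lemma21TwoScale.c1TwoScale`), the lineage's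
corrected two-scale constant, d-only — NOT the printed 12c₀(½α)^d (refuted as typed, `B6Lemma21Counterexample`); the
route is the two-sided lattice-drawing reconstruction of `B6Decomp247LatticeTwoSided` (print's (2.47)–(2.48)–(2.57) coding
with the corrected count), not a new count.  (e) (2.1)'s block structure of Ω_j enters only through the covering (2.4)
(`Tiles`: Ω_j∖Ω_{j+1} is a union of Lʲ-blocks); the size M of the big blocks plays no role in Lemma 2.1 beyond RM.
(f) NOT COVERED: anything analytic.  HONEST SCOPE: finite lattice geometry (collars,
corners, unit steps) feeding the bookkeeping Lemma 2.1 of a published proof as repaired in the tree, now at the generality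
of the paper's own hypotheses (2.1)–(2.2); NOT the printed constant, NOT progress on any Clay problem.
-/

namespace Literature.MathematicalPhysics.QuantumFieldTheory.Balaban1983to89.B6Lemma21PrintedDomains

open Literature.MathematicalPhysics.QuantumFieldTheory.Balaban1983to89
open B6Geometry B15Ineq147LevelGap B14DomainGeom B15TouchingCubeContours B15TouchingCubeDomains B15LatticeCubeContours
open Finset

variable {d : ℕ}

/-! ## §1 The ℓ¹ (lattice-contour) form of the collar (2.2) on the ℤᵈ carrier, and the stronger readings -/

section L1

/-- The ℓ¹ distance of two lattice points of ℤᵈ ≅ η⁻¹T_η (the length, in units of η, of a shortest lattice contour joining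
them — the quantity that (2.48) p. 232 compares with |Γ_{y,y′}|). [cite: Balaban1984PropagatorsII, (2.48) p.232] -/
def l1Dist (a b : Fin d → ℤ) : ℤ := ∑ μ, |a μ - b μ|

/-- ℓ¹ distance is symmetric. [folklore] -/
private theorem l1Dist_comm (a b : Fin d → ℤ) : l1Dist a b = l1Dist b a := by
  unfold l1Dist
  exact Finset.sum_congr rfl fun μ _ => abs_sub_comm _ _

/-- ℓ¹ distance is nonnegative. [folklore] -/
private theorem l1Dist_nonneg (a b : Fin d → ℤ) : 0 ≤ l1Dist a b :=
  Finset.sum_nonneg fun _ _ => abs_nonneg _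

/-- ℓ¹ distance of a point to itself. [folklore] -/
private theorem l1Dist_self (a : Fin d → ℤ) : l1Dist a a = 0 := by
  simp [l1Dist]

/-- Triangle inequality for the ℓ¹ distance. [folklore] -/
private theorem l1Dist_triangle (a b c : Fin d → ℤ) : l1Dist a c ≤ l1Dist a b + l1Dist b c := by
  unfold l1Dist
  rw [← Finset.sum_add_distrib]
  exact Finset.sum_le_sum fun μ _ => abs_sub_le _ _ _

/-- An axis move by `v` has ℓ¹ length `|v|`. [folklore] -/
private theorem l1Dist_add_single (a : Fin d → ℤ) (μ : Fin d) (v : ℤ) : l1Dist a (a + Pi.single μ v) = |v| := by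
  unfold l1Dist
  rw [Finset.sum_eq_single μ]
  · simp
  · intro ν _ hν
    simp [Pi.single_eq_of_ne hν]
  · intro h
    exact absurd (Finset.mem_univ μ) h

/-- Changing one coordinate moves a point by the change, in ℓ¹. [folklore] -/
private theorem l1Dist_update (a : Fin d → ℤ) (μ : Fin d) (w : ℤ) : l1Dist a (Function.update a μ w) = |a μ - w| := by
  unfold l1Dist
  rw [Finset.sum_eq_single μ]
  · simp
  · intro ν _ hν
    simp [Function.update_of_ne hν]
  · intro h
    exact absurd (Finset.mem_univ μ) h

/-- The sup distance of the cell's carrier (`toR`, the metric of `LayerSepZd`) is dominated by the ℓ¹ distance. [folklore] -/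
private theorem dist_toR_le_l1Dist (a b : Fin d → ℤ) : dist (toR a) (toR b) ≤ ((l1Dist a b : ℤ) : ℝ) := by
  have h0 : (0 : ℝ) ≤ ((l1Dist a b : ℤ) : ℝ) := by exact_mod_cast l1Dist_nonneg a b
  refine (dist_pi_le_iff h0).mpr fun μ => ?_
  rw [Real.dist_eq]
  unfold toR
  have h1 : |a μ - b μ| ≤ l1Dist a b := by
    unfold l1Dist
    exact Finset.single_le_sum (f := fun ν => |a ν - b ν|) (fun _ _ => abs_nonneg _) (Finset.mem_univ μ)
  have h2 : (|((a μ : ℤ) : ℝ) - ((b μ : ℤ) : ℝ)|) = (((|a μ - b μ| : ℤ)) : ℝ) := by push_cast; rfl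
  rw [h2]
  exact_mod_cast h1

/-- The lattice point `a ∈ ℤᵈ` as a point of Euclidean space `ℝᵈ` (for the Euclidean reading of «dist» in (2.2)).
[cite: Balaban1984PropagatorsII, (2.2) p.224] -/
noncomputable def toE (a : Fin d → ℤ) : EuclideanSpace ℝ (Fin d) := WithLp.toLp 2 (toR a)

/-- For nonnegative reals, `√(Σ sᵢ²) ≤ Σ sᵢ`. [folklore] -/
private theorem sqrt_sum_sq_le {ι : Type*} (T : Finset ι) (s : ι → ℝ) (hs : ∀ i ∈ T, 0 ≤ s i) :
    √(∑ i ∈ T, s i ^ 2) ≤ ∑ i ∈ T, s i := by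
  have hS : 0 ≤ ∑ i ∈ T, s i := Finset.sum_nonneg hs
  have h : ∑ i ∈ T, s i ^ 2 ≤ (∑ i ∈ T, s i) ^ 2 := by
    rw [sq, Finset.sum_mul]
    refine Finset.sum_le_sum fun i hi => ?_
    rw [sq]
    exact mul_le_mul_of_nonneg_left (Finset.single_le_sum hs hi) (hs i hi)
  calc √(∑ i ∈ T, s i ^ 2) ≤ √((∑ i ∈ T, s i) ^ 2) := Real.sqrt_le_sqrt h
    _ = ∑ i ∈ T, s i := Real.sqrt_sq hS

/-- The Euclidean distance is dominated by the ℓ¹ distance. [folklore] -/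
private theorem dist_toE_le_l1Dist (a b : Fin d → ℤ) : dist (toE a) (toE b) ≤ ((l1Dist a b : ℤ) : ℝ) := by
  rw [toE, toE, EuclideanSpace.dist_eq]
  have e : ∀ μ : Fin d, dist ((WithLp.toLp 2 (toR a) : EuclideanSpace ℝ (Fin d)) μ)
      ((WithLp.toLp 2 (toR b) : EuclideanSpace ℝ (Fin d)) μ) = (((|a μ - b μ| : ℤ)) : ℝ) := by
    intro μ
    rw [PiLp.toLp_apply, PiLp.toLp_apply, Real.dist_eq]
    unfold toR
    push_cast
    rfl
  simp_rw [e]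
  calc √(∑ μ, (((|a μ - b μ| : ℤ)) : ℝ) ^ 2) ≤ ∑ μ, (((|a μ - b μ| : ℤ)) : ℝ) :=
        sqrt_sum_sq_le _ _ fun μ _ => by exact_mod_cast abs_nonneg (a μ - b μ)
    _ = ((l1Dist a b : ℤ) : ℝ) := by unfold l1Dist; push_cast; rfl

variable {M₁ L : ℕ} {Z : ℕ → Set (Fin d → ℤ)}

/-- **THE COLLAR (2.2) ON THE CARRIER, ℓ¹ (lattice-contour) form**: a point of `Z_n` (= Ω_nᶜ) and a point outside `Z_{n+1}`
(= of Ω_{n+1}) are MORE than `N` sides `M₁Lⁿ` of a scale-n cube apart in ℓ¹ — print's *"(L^jη)^{−1} dist(Ω_j^c, Ω_{j+1}) >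
RM"* with `N = RM` (and `M₁ = 1`); a hypothesis shape, used only to the left of `→`. [cite: Balaban1984PropagatorsII, (2.2) p.224] -/
def SepZd (Z : ℕ → Set (Fin d → ℤ)) (M₁ L N : ℕ) : Prop :=
  ∀ ⦃n : ℕ⦄ ⦃a b : Fin d → ℤ⦄, a ∈ Z n → b ∉ Z (n + 1) → ((N * (M₁ * L ^ n) : ℕ) : ℤ) < l1Dist a b

/-- Monotonicity of the collar count: fewer bonds asked is weaker. [cite: Balaban1984PropagatorsII, (2.2) p.224] -/
theorem SepZd.mono {N N' : ℕ} (h : SepZd Z M₁ L N) (hle : N' ≤ N) : SepZd Z M₁ L N' := by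
  intro n a b ha hb
  have h1 := h ha hb
  have h2 : ((N' * (M₁ * L ^ n) : ℕ) : ℤ) ≤ ((N * (M₁ * L ^ n) : ℕ) : ℤ) := by
    exact_mod_cast Nat.mul_le_mul_right _ hle
  omega

/-- **The sup-norm reading of (2.2) implies the ℓ¹ form** with the same count: if points of `Z_n` and points outside `Z_{n+1}`
are more than `T·M₁Lⁿ` apart in the sup norm of the carrier (`toR`) and `N ≤ T`, then `SepZd Z M₁ L N`.
[cite: Balaban1984PropagatorsII, (2.2) p.224] -/
theorem sepZd_of_sup {T : ℝ} {N : ℕ}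
    (h : ∀ ⦃n : ℕ⦄ ⦃a b : Fin d → ℤ⦄, a ∈ Z n → b ∉ Z (n + 1) →
      T * ((M₁ * L ^ n : ℕ) : ℝ) < dist (toR a) (toR b))
    (hNT : (N : ℝ) ≤ T) : SepZd Z M₁ L N := by
  intro n a b ha hb
  have h1 := h ha hb
  have h2 := dist_toR_le_l1Dist a b
  have h3 : (N : ℝ) * ((M₁ * L ^ n : ℕ) : ℝ) ≤ T * ((M₁ * L ^ n : ℕ) : ℝ) :=
    mul_le_mul_of_nonneg_right hNT (Nat.cast_nonneg _)
  have h4 : (((N * (M₁ * L ^ n) : ℕ) : ℤ) : ℝ) < ((l1Dist a b : ℤ) : ℝ) := by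
    push_cast at h1 h3 ⊢
    linarith
  exact_mod_cast h4

/-- **The Euclidean reading of (2.2) implies the ℓ¹ form** with the same count. [cite: Balaban1984PropagatorsII, (2.2) p.224] -/
theorem sepZd_of_eucl {T : ℝ} {N : ℕ}
    (h : ∀ ⦃n : ℕ⦄ ⦃a b : Fin d → ℤ⦄, a ∈ Z n → b ∉ Z (n + 1) →
      T * ((M₁ * L ^ n : ℕ) : ℝ) < dist (toE a) (toE b))
    (hNT : (N : ℝ) ≤ T) : SepZd Z M₁ L N := by
  intro n a b ha hb
  have h1 := h ha hb
  have h2 := dist_toE_le_l1Dist a b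
  have h3 : (N : ℝ) * ((M₁ * L ^ n : ℕ) : ℝ) ≤ T * ((M₁ * L ^ n : ℕ) : ℝ) :=
    mul_le_mul_of_nonneg_right hNT (Nat.cast_nonneg _)
  have h4 : (((N * (M₁ * L ^ n) : ℕ) : ℤ) : ℝ) < ((l1Dist a b : ℤ) : ℝ) := by
    push_cast at h1 h3 ⊢
    linarith
  exact_mod_cast h4

/-- **The [III]/[IV] one-cube collar implies the ℓ¹ form**: `LayerSepZd Z M L` (one layer of `ML^{n+1}`-cubes between `Z_n` and
`(Z_{n+1})ᶜ`, sup norm — the hypothesis of `B15LatticeCubeContours.lemma21_full_latGeo`) gives `SepZd Z M₁ L N` for EVERY count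
`N` with `N·M₁ < M·L` (e.g. `N = L·(M/M₁) − 1`, not only the `M/M₁` used there). [cite: Balaban1989LargeFieldI, p.179; Balaban1984PropagatorsII, (2.2) p.224] -/
theorem sepZd_of_layerSepZd {M N : ℕ} (h : LayerSepZd Z M L) (hL : 0 < L) (hN : N * M₁ < M * L) : SepZd Z M₁ L N := by
  intro n a b ha hb
  have h1 := h ha hb
  have h2 := dist_toR_le_l1Dist a b
  have hLn : (0 : ℝ) < (L : ℝ) ^ n := by positivity
  have h3 : ((N * M₁ : ℕ) : ℝ) + 1 ≤ ((M * L : ℕ) : ℝ) := by exact_mod_cast hN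
  have h4 : (((N * (M₁ * L ^ n) : ℕ) : ℤ) : ℝ) < ((l1Dist a b : ℤ) : ℝ) := by
    have e1 : (((N * (M₁ * L ^ n) : ℕ) : ℤ) : ℝ) = ((N * M₁ : ℕ) : ℝ) * (L : ℝ) ^ n := by push_cast; ring
    have e2 : (M : ℝ) * (L : ℝ) ^ (n + 1) = ((M * L : ℕ) : ℝ) * (L : ℝ) ^ n := by push_cast; ring
    rw [e1]
    rw [e2] at h1
    have h5 : ((N * M₁ : ℕ) : ℝ) * (L : ℝ) ^ n < ((M * L : ℕ) : ℝ) * (L : ℝ) ^ n := by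
      have := mul_le_mul_of_nonneg_right h3 hLn.le
      nlinarith
    linarith
  exact_mod_cast h4

end L1

/-! ## §2 The walk form of (2.57) with print's RM: `LevelGap latC zoneC N` from the ℓ¹ collar -/

section Gap

variable {M₁ L : ℕ} {Z : ℕ → Set (Fin d → ℤ)}

/-- The corner of the cube-site `(n, c)` is `M₁Lⁿ·c`. [folklore] -/
private theorem cornerC_apply (s : CubeSite M₁ L Z) (ν : Fin d) :
    cornerC s ν = ((M₁ * L ^ s.1.1 : ℕ) : ℤ) * s.1.2 ν := rfl

/-- Membership in a cube, unfolded. [folklore] -/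
private theorem mem_cube {n : ℕ} {c x : Fin d → ℤ} :
    x ∈ cube M₁ L n c ↔ ∀ μ, ((M₁ * L ^ n : ℕ) : ℤ) * c μ ≤ x μ ∧ x μ < ((M₁ * L ^ n : ℕ) : ℤ) * (c μ + 1) := Iff.rfl

/-- The sides grow with the scale (`L ≥ 1`). [folklore] -/
private theorem side_le_side (hL : 1 ≤ L) {m i : ℕ} (h : m ≤ i) :
    ((M₁ * L ^ m : ℕ) : ℤ) ≤ ((M₁ * L ^ i : ℕ) : ℤ) := by
  exact_mod_cast Nat.mul_le_mul_left M₁ (Nat.pow_le_pow_right hL h)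

/-- A bond of `latC` between two cubes of scale `≤ i` moves the corner by at most one scale-i side in ℓ¹ (it is an axis move
by the side of one of the two cubes). [cite: Balaban1984PropagatorsII, (2.46) p.231, (2.48) p.232] -/
theorem l1Dist_cornerC_le_of_adj (hL : 1 ≤ L) {i : ℕ} {s v : CubeSite M₁ L Z} (h : (latC M₁ L Z).Adj s v)
    (hs : zoneC s ≤ i) (hv : zoneC v ≤ i) : l1Dist (cornerC s) (cornerC v) ≤ ((M₁ * L ^ i : ℕ) : ℤ) := by
  obtain ⟨-, ⟨μ, hμ⟩ | ⟨μ, hμ⟩⟩ := latC_adj.mp h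
  · rw [hμ, l1Dist_add_single, sideZ, abs_of_nonneg (by positivity)]
    exact side_le_side hL hs
  · rw [l1Dist_comm, hμ, l1Dist_add_single, sideZ, abs_of_nonneg (by positivity)]
    exact side_le_side hL hv

/-- **The last bond** (the only place where reading R0 differs from the touching/finer readings): if a cube `s` of scale `≤ i`
is joined to ANY cube `b`, some lattice point of `b` is within one scale-i side of the corner of `s` in ℓ¹ — for a bond of the
lattice of `s` the corner of `b` itself, for a bond of the (possibly coarser) lattice of `b` along an edge of `b` ending at the
corner of `s` the last lattice point of `b` on that edge, at ℓ¹-distance 1. [cite: Balaban1984PropagatorsII, (2.46) p.231, (2.48) p.232, (2.57) p.233] -/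
theorem exists_near_of_adj (hM₁ : 0 < M₁) (hL : 1 ≤ L) {i : ℕ} {s b : CubeSite M₁ L Z} (h : (latC M₁ L Z).Adj s b)
    (hs : zoneC s ≤ i) : ∃ β ∈ cube M₁ L b.1.1 b.1.2, l1Dist (cornerC s) β ≤ ((M₁ * L ^ i : ℕ) : ℤ) := by
  have hSb : 0 < M₁ * L ^ b.1.1 := Nat.mul_pos hM₁ (Nat.pow_pos (by omega))
  have hSi : (1 : ℤ) ≤ ((M₁ * L ^ i : ℕ) : ℤ) := by exact_mod_cast Nat.mul_pos hM₁ (Nat.pow_pos (by omega))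
  obtain ⟨-, ⟨μ, hμ⟩ | ⟨μ, hμ⟩⟩ := latC_adj.mp h
  · refine ⟨cornerC b, corner_mem_cube hSb _, ?_⟩
    rw [hμ, l1Dist_add_single, sideZ, abs_of_nonneg (by positivity)]
    exact side_le_side hL hs
  · -- the bond of the lattice of b: cornerC s = cornerC b + side(b)·e_μ; take the last point of b on that edge
    refine ⟨cornerC b + Pi.single μ (sideZ M₁ L (zoneC b) - 1), ?_, ?_⟩
    · rw [mem_cube]
      intro ν
      rw [Pi.add_apply, cornerC_apply]
      by_cases hν : ν = μ
      · subst hν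
        rw [Pi.single_eq_same, sideZ, zoneC]
        have : (1 : ℤ) ≤ ((M₁ * L ^ b.1.1 : ℕ) : ℤ) := by exact_mod_cast hSb
        constructor <;> nlinarith
      · rw [Pi.single_eq_of_ne hν, add_zero]
        have : (1 : ℤ) ≤ ((M₁ * L ^ b.1.1 : ℕ) : ℤ) := by exact_mod_cast hSb
        constructor <;> nlinarith
    · rw [hμ]
      have e : cornerC b + Pi.single μ (sideZ M₁ L (zoneC b) - 1) =
          (cornerC b + Pi.single μ (sideZ M₁ L (zoneC b))) + Pi.single μ (-1) := by
        rw [add_assoc, ← Pi.single_add]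
        ring_nf
      rw [e, l1Dist_add_single]
      simp only [abs_neg, abs_one]
      exact hSi

/-- **Point chains along lattice contours** (print's (2.48) summed): if every bond of a chain STARTS in a cube of scale `≤ i`,
some lattice point of the last cube is within (number of bonds)·(scale-i side) of the corner of the first cube, in ℓ¹.
[cite: Balaban1984PropagatorsII, (2.48) p.232, (2.57) p.233] -/
theorem exists_point_of_walk (hM₁ : 0 < M₁) (hL : 1 ≤ L) (i : ℕ) :
    ∀ {s b : CubeSite M₁ L Z} (q : (latC M₁ L Z).Walk s b), (∀ e ∈ q.darts, zoneC e.fst ≤ i) →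
      ∃ β ∈ cube M₁ L b.1.1 b.1.2, l1Dist (cornerC s) β ≤ (q.length : ℤ) * ((M₁ * L ^ i : ℕ) : ℤ) := by
  intro s b q
  induction q with
  | nil =>
    intro _
    exact ⟨cornerC _, corner_mem_cube (Nat.mul_pos hM₁ (Nat.pow_pos (by omega))) _, by rw [l1Dist_self]; simp⟩
  | @cons u v w h q ih =>
    intro hd
    have hu : zoneC u ≤ i := hd ⟨(u, v), h⟩ (by simp [SimpleGraph.Walk.darts_cons])
    cases q with
    | nil =>
      obtain ⟨β, hβ, hd1⟩ := exists_near_of_adj hM₁ hL h hu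
      refine ⟨β, hβ, ?_⟩
      simp only [SimpleGraph.Walk.length_cons, SimpleGraph.Walk.length_nil, zero_add, Nat.cast_one, one_mul]
      exact hd1
    | cons h' q' =>
      have hv : zoneC v ≤ i := hd ⟨(v, _), h'⟩ (by simp [SimpleGraph.Walk.darts_cons])
      obtain ⟨β, hβ, hd2⟩ :=
        ih (fun e he => hd e (by rw [SimpleGraph.Walk.darts_cons]; exact List.mem_cons_of_mem _ he))
      refine ⟨β, hβ, ?_⟩
      have h1 := l1Dist_cornerC_le_of_adj hL h hu hv
      have h2 := l1Dist_triangle (cornerC u) (cornerC v) β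
      rw [SimpleGraph.Walk.length_cons, Nat.cast_succ, add_mul, one_mul]
      linarith

/-- First crossing with the scales of the STARTING points recorded: a walk from zone `≤ i` to zone `> i` has an initial
segment ending in zone `> i`, every bond of which starts in zone `≤ i` (as in `B15TouchingCubeContours`). [folklore] -/
private theorem exists_prefix_fst {V : Type*} {G : SimpleGraph V} (zone : V → ℕ) (i : ℕ) :
    ∀ {v x : V} (p : G.Walk v x), zone v ≤ i → i < zone x →
      ∃ (b : V) (q : G.Walk v b), i < zone b ∧ q.length ≤ p.length ∧ ∀ e ∈ q.darts, zone e.fst ≤ i := by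
  intro v x p
  induction p with
  | nil => intro hv hx; omega
  | @cons a b c h p ih =>
    intro ha hc
    by_cases hb : i < zone b
    · refine ⟨b, SimpleGraph.Walk.cons h SimpleGraph.Walk.nil, hb, ?_, ?_⟩
      · simp only [SimpleGraph.Walk.length_cons, SimpleGraph.Walk.length_nil]; omega
      · intro e he
        rw [SimpleGraph.Walk.darts_cons, SimpleGraph.Walk.darts_nil, List.mem_singleton] at he
        subst he
        exact ha
    · obtain ⟨b', q, hb', hq, hd⟩ := ih (not_lt.mp hb) hc
      refine ⟨b', SimpleGraph.Walk.cons h q, hb', ?_, ?_⟩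
      · simp only [SimpleGraph.Walk.length_cons]; omega
      · intro e he
        rw [SimpleGraph.Walk.darts_cons, List.mem_cons] at he
        rcases he with rfl | he
        · exact ha
        · exact hd e he

/-- **THE WALK FORM OF (2.57) WITH PRINT'S RM.**  Nested `Z_n ⊂ ℤᵈ` with the ℓ¹ collar `SepZd Z M₁ L N` (points of `Z_n` and
points outside `Z_{n+1}` more than `N` scale-n sides apart; print: N = RM, M₁ = 1), `M₁ ≥ 1`, `L ≥ 1`: every chain of lattice
bonds (reading R0) from a cube of scale `< i` to a cube of scale `> i` has at least `N + 1` bonds — `LevelGap (latC M₁ L Z)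
zoneC N` — by the point chain of `exists_point_of_walk` between the corner of the first cube (a point of `Z_i`) and a lattice
point of the first cube of scale `> i` (a point outside `Z_{i+1}`).  Compare `B15LatticeCubeContours.levelGap_latC` (count
`M/M₁` from the one-cube collar `LayerSepZd Z M L`). [cite: Balaban1984PropagatorsII, (2.2) p.224, (2.57) p.233] -/
theorem levelGap_latC_of_sepZd {N : ℕ} (hmono : Monotone Z) (hsep : SepZd Z M₁ L N) (hM₁ : 0 < M₁) (hL : 1 ≤ L) :
    LevelGap (latC M₁ L Z) zoneC N := by
  intro i u x hu hx p
  obtain ⟨b, q, hb, hqp, hfst⟩ := exists_prefix_fst zoneC i p hu.le hx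
  obtain ⟨β, hβ, hchain⟩ := exists_point_of_walk hM₁ hL i q hfst
  have ha : cornerC u ∈ Z i := hmono (show u.1.1 + 1 ≤ i from hu) (corner_mem_layer hM₁ (by omega) u).1
  have hβ' : β ∉ Z (i + 1) := fun hmem => (b.2 hβ).2 (hmono (show i + 1 ≤ b.1.1 from hb) hmem)
  have hgap := hsep ha hβ'
  have hS : (0 : ℤ) < ((M₁ * L ^ i : ℕ) : ℤ) := by exact_mod_cast Nat.mul_pos hM₁ (Nat.pow_pos (by omega))
  have key : (N : ℤ) < q.length := by
    have h1 : ((N * (M₁ * L ^ i) : ℕ) : ℤ) < (q.length : ℤ) * ((M₁ * L ^ i : ℕ) : ℤ) := lt_of_lt_of_le hgap hchain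
    push_cast at h1
    exact lt_of_mul_lt_mul_right h1 hS.le
  omega

/-- *"The surface Σ_j separates …"*: under the ℓ¹ collar with `N ≥ 1`, cubes joined by a lattice bond have equal or consecutive
scales. [cite: Balaban1984PropagatorsII, p.231, (2.2) p.224] -/
theorem separates_latC_of_sepZd {N : ℕ} (hmono : Monotone Z) (hsep : SepZd Z M₁ L N) (hN : 1 ≤ N) (hM₁ : 0 < M₁)
    (hL : 1 ≤ L) : Separates (latC M₁ L Z) zoneC :=
  separates_of_levelGap (levelGap_latC_of_sepZd hmono hsep hM₁ hL) (by omega)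

/-- (1.47)-type multi-level form: a chain of lattice bonds from scale `≤ i` to scale `≥ j + 1` has at least `N·(j − i)` bonds.
[cite: Balaban1984PropagatorsII, (2.57) p.233, (2.60) p.234] -/
theorem walk_length_ge_of_sepZd {N : ℕ} (hmono : Monotone Z) (hsep : SepZd Z M₁ L N) (hM₁ : 0 < M₁) (hL : 1 ≤ L)
    {i j : ℕ} {s t : CubeSite M₁ L Z} (p : (latC M₁ L Z).Walk s t) (hs : zoneC s ≤ i) (ht : j + 1 ≤ zoneC t) :
    N * (j - i) ≤ p.length :=
  length_ge_mul_of_levelGap (levelGap_latC_of_sepZd hmono hsep hM₁ hL) p hs ht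

end Gap

/-! ## §3 The admissible contours EXIST under the ℓ¹ collar: `latC` is connected -/

section Connected

variable {M₁ L : ℕ} {Z : ℕ → Set (Fin d → ℤ)}

/-- From `S·a ≤ x < S·(b+1)` (S > 0): `a ≤ b`. [folklore] -/
private theorem idx_le_of_bounds {S a b x : ℤ} (hS : 0 < S) (h1 : S * a ≤ x) (h2 : x < S * (b + 1)) : a ≤ b := by
  have h : S * a < S * (b + 1) := lt_of_le_of_lt h1 h2
  have := lt_of_mul_lt_mul_left h hS.le
  omega

/-- A union of `s·t`-cubes is a union of `s`-cubes (nested partitions). [folklore] -/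
private theorem isUnionOfCubes_of_mul {s t : ℕ} {Λ : Set (Fin d → ℤ)} (h : IsUnionOfCubes (s * t) Λ) :
    IsUnionOfCubes s Λ := by
  intro x y hxy
  apply h
  funext i
  have hi := congrFun hxy i
  unfold cubeIdx at hi ⊢
  push_cast
  rw [← Int.ediv_ediv_of_nonneg (Int.natCast_nonneg s), ← Int.ediv_ediv_of_nonneg (Int.natCast_nonneg s), hi]

/-- A cube is a union of the partition cubes of any finer scale. [folklore] -/
private theorem mem_cube_of_sameIdx {n m : ℕ} (hmn : n ≤ m) (hM₁ : 0 < M₁) (hL : 0 < L) {c z y : Fin d → ℤ}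
    (hz : z ∈ cube M₁ L m c) (hzy : cubeIdx (M₁ * L ^ n) z = cubeIdx (M₁ * L ^ n) y) : y ∈ cube M₁ L m c := by
  have hSm : 0 < M₁ * L ^ m := Nat.mul_pos hM₁ (Nat.pow_pos hL)
  have hU : IsUnionOfCubes (M₁ * L ^ m) (cube M₁ L m c) := fun a b hab => by
    rw [mem_cube_iff_cubeIdx hSm, mem_cube_iff_cubeIdx hSm, hab]
  have e : M₁ * L ^ m = M₁ * L ^ n * L ^ (m - n) := by
    rw [mul_assoc, ← pow_add, Nat.add_sub_cancel' hmn]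
  rw [e] at hU
  exact ((isUnionOfCubes_of_mul hU) z y hzy).mp hz

/-- **Scales of face-adjacent cubes differ by at most one** under the ℓ¹ collar with `N ≥ 1` (a lattice point x of one cube and
x + e_μ of the other are at ℓ¹-distance 1 ≤ N·M₁Lⁿ, so they cannot lie on the two sides of a collar).
[cite: Balaban1984PropagatorsII, p.231, (2.2) p.224] -/
theorem zone_le_succ_of_unitStep {N : ℕ} (hmono : Monotone Z) (hsep : SepZd Z M₁ L N) (hN : 1 ≤ N) (hM₁ : 0 < M₁)
    (hL : 1 ≤ L) {s t : CubeSite M₁ L Z} {x : Fin d → ℤ} {μ : Fin d} (hx : x ∈ cube M₁ L s.1.1 s.1.2)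
    (hy : Function.update x μ (x μ + 1) ∈ cube M₁ L t.1.1 t.1.2) : t.1.1 ≤ s.1.1 + 1 ∧ s.1.1 ≤ t.1.1 + 1 := by
  have hone : l1Dist x (Function.update x μ (x μ + 1)) = 1 := by
    rw [l1Dist_update]; simp
  have hge : ∀ n, (1 : ℤ) ≤ ((N * (M₁ * L ^ n) : ℕ) : ℤ) := fun n => by
    exact_mod_cast Nat.mul_pos (by omega) (Nat.mul_pos hM₁ (Nat.pow_pos (by omega)))
  have hxl := s.2 hx
  have hyl := t.2 hy
  constructor
  · by_contra hlt
    have h1 : x ∈ Z (t.1.1 - 1) := hmono (show s.1.1 + 1 ≤ t.1.1 - 1 by omega) hxl.1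
    have h2 : Function.update x μ (x μ + 1) ∉ Z (t.1.1 - 1 + 1) := by
      rw [show t.1.1 - 1 + 1 = t.1.1 by omega]; exact hyl.2
    have := hsep h1 h2
    rw [hone] at this
    exact absurd this (not_lt.mpr (hge _))
  · by_contra hlt
    have h1 : Function.update x μ (x μ + 1) ∈ Z (s.1.1 - 1) := hmono (show t.1.1 + 1 ≤ s.1.1 - 1 by omega) hyl.1
    have h2 : x ∉ Z (s.1.1 - 1 + 1) := by
      rw [show s.1.1 - 1 + 1 = s.1.1 by omega]; exact hxl.2
    have := hsep h1 h2
    rw [l1Dist_comm, hone] at this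
    exact absurd this (not_lt.mpr (hge _))

/-- **THE SLAB LEMMA under the ℓ¹ collar** (the collar of a coarse cube is made of cubes of the next finer scale): let t be a
cube-site of scale n + 1 and W a set of lattice points inside ONE scale-(n+1) partition cube, every point of which is within
ONE scale-n side `M₁Lⁿ` of the cube of t in ℓ¹; if ONE point of W lies in a scale-n cube-site, then EVERY point of W lies in
the layer `Z_{n+1}∖Z_n` (nested `Z`, the collar `SepZd Z M₁ L N` with `N ≥ 1`, the covering, `M₁ ≥ 1`, `L ≥ 2`).  Step (i)
— a point of W is not in `Z_n` — is where `B15LatticeCubeContours.layer_of_near` used the [III] one-cube collar; step (ii) is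
unchanged. [cite: Balaban1984PropagatorsII, (2.2)–(2.4) p.224] -/
theorem layer_of_near_sepZd {N : ℕ} (hmono : Monotone Z) (hsep : SepZd Z M₁ L N) (hN : 1 ≤ N) (ht : Tiles M₁ L Z)
    (hM₁ : 0 < M₁) (hL : 2 ≤ L) {n : ℕ} (t : CubeSite M₁ L Z) (htn : t.1.1 = n + 1) (c₀ : Fin d → ℤ)
    {W : Set (Fin d → ℤ)} (hWB : W ⊆ cube M₁ L (n + 1) c₀)
    (hnear : ∀ z ∈ W, ∃ b ∈ cube M₁ L t.1.1 t.1.2, l1Dist z b ≤ ((M₁ * L ^ n : ℕ) : ℤ))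
    {s : CubeSite M₁ L Z} (hsn : s.1.1 = n) {x : Fin d → ℤ} (hxs : x ∈ cube M₁ L s.1.1 s.1.2) (hxW : x ∈ W) :
    ∀ z ∈ W, z ∈ Z (n + 1) \ Z n := by
  intro z hzW
  have hL0 : 0 < L := by omega
  have hSn1 : 0 < M₁ * L ^ (n + 1) := Nat.mul_pos hM₁ (Nat.pow_pos hL0)
  -- (i) z ∉ Z_n: it is within one scale-n side of the cube of t, which lies outside Z_{n+1}
  have hzn : z ∉ Z n := by
    intro hz
    obtain ⟨b, hb, hdb⟩ := hnear z hzW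
    have hb' : b ∉ Z (n + 1) := by
      have := (t.2 hb).2
      rwa [htn] at this
    have hfar := hsep hz hb'
    have hle : ((M₁ * L ^ n : ℕ) : ℤ) ≤ ((N * (M₁ * L ^ n) : ℕ) : ℤ) := by
      exact_mod_cast Nat.le_mul_of_pos_left _ (by omega)
    omega
  -- (ii) the cube-site of z has scale n
  obtain ⟨u, hu⟩ := ht z
  have hum : u.1.1 = n := by
    have hzl := u.2 hu
    rcases Nat.lt_trichotomy u.1.1 n with hlt | heq | hgt
    · exact absurd (hmono (show u.1.1 + 1 ≤ n by omega) hzl.1) hzn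
    · exact heq
    · exfalso
      have hzB : z ∈ cube M₁ L (n + 1) c₀ := hWB hzW
      have hxB : x ∈ cube M₁ L (n + 1) c₀ := hWB hxW
      have hidx : cubeIdx (M₁ * L ^ (n + 1)) z = cubeIdx (M₁ * L ^ (n + 1)) x := by
        rw [(mem_cube_iff_cubeIdx hSn1).mp hzB, (mem_cube_iff_cubeIdx hSn1).mp hxB]
      have hxu : x ∈ cube M₁ L u.1.1 u.1.2 := mem_cube_of_sameIdx (by omega) hM₁ hL0 hu hidx
      have := site_eq_of_mem hmono hM₁ hL0 hxu hxs
      rw [this] at hgt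
      omega
  have := u.2 hu
  rwa [hum] at this

/-- Face equations of two DIFFERENT cube-sites s ∋ x and t ∋ x + e_μ. [folklore] -/
private theorem face_eqs (hmono : Monotone Z) (hM₁ : 0 < M₁) (hL : 0 < L) {s t : CubeSite M₁ L Z} (hst : s ≠ t)
    {x : Fin d → ℤ} {μ : Fin d} (hx : x ∈ cube M₁ L s.1.1 s.1.2)
    (hy : Function.update x μ (x μ + 1) ∈ cube M₁ L t.1.1 t.1.2) :
    x μ + 1 = ((M₁ * L ^ s.1.1 : ℕ) : ℤ) * (s.1.2 μ + 1) ∧ x μ + 1 = ((M₁ * L ^ t.1.1 : ℕ) : ℤ) * t.1.2 μ := by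
  have hx' := (mem_cube (M₁ := M₁)).mp hx
  have hy' := (mem_cube (M₁ := M₁)).mp hy
  constructor
  · by_contra hne
    apply hst
    refine site_eq_of_mem hmono hM₁ hL (x := Function.update x μ (x μ + 1)) ?_ hy
    rw [mem_cube]
    intro ν
    by_cases hν : ν = μ
    · subst hν
      rw [Function.update_self]
      have := hx' ν
      constructor <;> omega
    · rw [Function.update_of_ne hν]
      exact hx' ν
  · by_contra hne
    apply hst
    refine site_eq_of_mem hmono hM₁ hL hx (x := x) ?_
    rw [mem_cube]
    intro ν
    have h := hy' ν
    by_cases hν : ν = μ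
    · subst hν
      rw [Function.update_self] at h
      constructor <;> omega
    · rw [Function.update_of_ne hν] at h
      exact h

/-- Same scale: the cube of x + e_μ is the next cube, one Λ_n-bond away. [cite: Balaban1984PropagatorsII, (2.46) p.231] -/
private theorem adj_of_step_same (hmono : Monotone Z) (hM₁ : 0 < M₁) (hL : 0 < L) {s t : CubeSite M₁ L Z} (hst : s ≠ t)
    (hn : t.1.1 = s.1.1) {x : Fin d → ℤ} {μ : Fin d} (hx : x ∈ cube M₁ L s.1.1 s.1.2)
    (hy : Function.update x μ (x μ + 1) ∈ cube M₁ L t.1.1 t.1.2) : (latC M₁ L Z).Adj s t := by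
  obtain ⟨hF1, hF2⟩ := face_eqs hmono hM₁ hL hst hx hy
  have hx' := (mem_cube (M₁ := M₁)).mp hx
  have hy' := (mem_cube (M₁ := M₁)).mp hy
  rw [hn] at hF2 hy'
  have hS : (0 : ℤ) < ((M₁ * L ^ s.1.1 : ℕ) : ℤ) := by exact_mod_cast Nat.mul_pos hM₁ (Nat.pow_pos hL)
  refine latC_adj_of_idx_succ hn (μ := μ) (funext fun ν => ?_)
  by_cases hν : ν = μ
  · subst hν
    rw [Function.update_self]
    exact mul_left_cancel₀ hS.ne' (hF2.symm.trans hF1)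
  · rw [Function.update_of_ne hν]
    have h1 := hx' ν
    have h2 := hy' ν
    rw [Function.update_of_ne hν] at h2
    have a := idx_le_of_bounds hS h1.1 h2.2
    have b := idx_le_of_bounds hS h2.1 h1.2
    omega

set_option maxHeartbeats 400000 in
/-- **Into a coarser cube** (x in a scale-n cube-site s, x + e_μ in a scale-(n+1) cube-site t): s is joined by Λ_n-bonds along
the −e_μ face of t (all cubes there are scale-n sites, `layer_of_near_sepZd`) to the scale-n cube at the corner of t, one
Λ_n-bond from t — the proof of `B15LatticeCubeContours.reachable_of_step_up` under the ℓ¹ collar. [cite: Balaban1984PropagatorsII, (2.46) p.231] -/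
private theorem reachable_of_step_up {N : ℕ} (hmono : Monotone Z) (hsep : SepZd Z M₁ L N) (hN : 1 ≤ N)
    (ht : Tiles M₁ L Z) (hM₁ : 0 < M₁) (hL : 2 ≤ L) {n : ℕ} {s t : CubeSite M₁ L Z} (hsn : s.1.1 = n)
    (htn : t.1.1 = n + 1) {x : Fin d → ℤ} {μ : Fin d} (hx : x ∈ cube M₁ L s.1.1 s.1.2)
    (hy : Function.update x μ (x μ + 1) ∈ cube M₁ L t.1.1 t.1.2) : (latC M₁ L Z).Reachable s t := by
  classical
  have hL0 : 0 < L := by omega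
  have hst : s ≠ t := fun h => by rw [h, htn] at hsn; omega
  obtain ⟨hF1, hF2⟩ := face_eqs hmono hM₁ hL0 hst hx hy
  have hx' := (mem_cube (M₁ := M₁)).mp hx
  have hy' := (mem_cube (M₁ := M₁)).mp hy
  rw [hsn] at hF1 hx'
  rw [htn] at hF2 hy'
  set S : ℤ := ((M₁ * L ^ n : ℕ) : ℤ) with hSdef
  set S' : ℤ := ((M₁ * L ^ (n + 1) : ℕ) : ℤ) with hS'def
  set c := s.1.2 with hcdef
  set c' := t.1.2 with hc'def
  set F := x μ + 1 with hFdef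
  have hSpos : 0 < M₁ * L ^ n := Nat.mul_pos hM₁ (Nat.pow_pos hL0)
  have hS0 : (0 : ℤ) < S := by rw [hSdef]; exact_mod_cast hSpos
  have hS1 : (1 : ℤ) ≤ S := hS0
  have hSS : S' = S * (L : ℤ) := by rw [hS'def, hSdef]; push_cast; ring
  have hL1 : (1 : ℤ) ≤ (L : ℤ) := by exact_mod_cast hL0
  have hSle : S ≤ S' := by rw [hSS]; nlinarith
  -- the slab of thickness S under the face x_μ = F of t
  let W : Set (Fin d → ℤ) :=
    {z | F - S ≤ z μ ∧ z μ < F ∧ ∀ ν, ν ≠ μ → S' * c' ν ≤ z ν ∧ z ν < S' * (c' ν + 1)}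
  have hWB : W ⊆ cube M₁ L (n + 1) (Function.update c' μ (c' μ - 1)) := by
    intro z hz
    obtain ⟨hz1, hz2, hz3⟩ := hz
    rw [mem_cube]
    intro ν
    by_cases hν : ν = μ
    · subst hν
      rw [Function.update_self, sub_add_cancel, ← hS'def]
      constructor <;> nlinarith
    · rw [Function.update_of_ne hν, ← hS'def]
      exact hz3 ν hν
  have hnear : ∀ z ∈ W, ∃ b ∈ cube M₁ L t.1.1 t.1.2, l1Dist z b ≤ ((M₁ * L ^ n : ℕ) : ℤ) := by
    intro z hz
    obtain ⟨hz1, hz2, hz3⟩ := hz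
    refine ⟨Function.update z μ F, ?_, ?_⟩
    · rw [htn, mem_cube]
      intro ν
      by_cases hν : ν = μ
      · subst hν
        rw [Function.update_self, ← hS'def]
        constructor <;> nlinarith
      · rw [Function.update_of_ne hν, ← hS'def]
        exact hz3 ν hν
    · rw [l1Dist_update, ← hSdef, abs_le]
      constructor <;> omega
  have hxW : x ∈ W := by
    refine ⟨by omega, by omega, fun ν hν => ?_⟩
    have h := hy' ν
    rwa [Function.update_of_ne hν] at h
  have hlayer := layer_of_near_sepZd hmono hsep hN ht hM₁ hL t htn _ hWB hnear (s := s) hsn hx hxW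
  -- the box of scale-n cubes under that face
  let lo : Fin d → ℤ := Function.update (fun ν => (L : ℤ) * c' ν) μ (c μ)
  let hi : Fin d → ℤ := Function.update (fun ν => (L : ℤ) * c' ν + L - 1) μ (c μ)
  have hbox : ∀ e : Fin d → ℤ, (∀ ν, lo ν ≤ e ν ∧ e ν ≤ hi ν) → cube M₁ L n e ⊆ Z (n + 1) \ Z n := by
    intro e he z hz
    apply hlayer z
    rw [mem_cube, ← hSdef] at hz
    have heμ : e μ = c μ := by
      have h := he μ
      simp only [lo, hi, Function.update_self] at h
      omega
    refine ⟨?_, ?_, fun ν hν => ?_⟩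
    · have := (hz μ).1; rw [heμ] at this; nlinarith
    · have := (hz μ).2; rw [heμ] at this; nlinarith
    · have h := he ν
      simp only [lo, hi, Function.update_of_ne hν] at h
      have h1 := (hz ν).1
      have h2 := (hz ν).2
      rw [hSS]
      constructor <;> nlinarith
  have hsbox : ∀ ν, lo ν ≤ c ν ∧ c ν ≤ hi ν := by
    intro ν
    by_cases hν : ν = μ
    · subst hν
      simp only [lo, hi, Function.update_self]
      omega
    · simp only [lo, hi, Function.update_of_ne hν]
      have h1 := hx' ν
      have h2 := hy' ν
      rw [Function.update_of_ne hν, hSS] at h2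
      have ea : S * ((L : ℤ) * c' ν) = S * (L : ℤ) * c' ν := by ring
      have eb : S * ((L : ℤ) * c' ν + L - 1 + 1) = S * (L : ℤ) * (c' ν + 1) := by ring
      have a : (L : ℤ) * c' ν ≤ c ν := idx_le_of_bounds hS0 (by rw [ea]; exact h2.1) h1.2
      have b : c ν ≤ (L : ℤ) * c' ν + L - 1 := idx_le_of_bounds hS0 h1.1 (by rw [eb]; exact h2.2)
      exact ⟨a, b⟩
  -- the scale-n cube at the corner of t
  let e₀ : Fin d → ℤ := Function.update (fun ν => (L : ℤ) * c' ν) μ (c μ)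
  have he₀ : ∀ ν, lo ν ≤ e₀ ν ∧ e₀ ν ≤ hi ν := by
    intro ν
    by_cases hν : ν = μ
    · subst hν
      simp only [lo, hi, e₀, Function.update_self]
      omega
    · simp only [lo, hi, e₀, Function.update_of_ne hν]
      constructor <;> nlinarith
  let k₀ : CubeSite M₁ L Z := ⟨(n, e₀), hbox e₀ he₀⟩
  have h1 : (latC M₁ L Z).Reachable s k₀ := reachable_in_box n lo hi hbox s k₀ hsn rfl hsbox he₀
  have h2 : (latC M₁ L Z).Adj k₀ t := by
    refine latC_adj.mpr ⟨fun h => ?_, Or.inl ⟨μ, funext fun ν => ?_⟩⟩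
    · have h' : k₀.1.1 = t.1.1 := congrArg (fun w : CubeSite M₁ L Z => w.1.1) h
      change n = t.1.1 at h'
      omega
    · rw [Pi.add_apply, cornerC_apply, cornerC_apply, htn]
      change S' * c' ν = S * e₀ ν + (Pi.single μ S : Fin d → ℤ) ν
      by_cases hν : ν = μ
      · subst hν
        simp only [e₀, Function.update_self, Pi.single_eq_same]
        linear_combination hF1 - hF2
      · simp only [e₀, Function.update_of_ne hν, Pi.single_eq_of_ne hν, add_zero]
        rw [hSS]
        ring
  exact h1.trans h2.reachable

set_option maxHeartbeats 400000 in
/-- **Into a finer cube** (x in a scale-(n+1) cube-site s, x + e_μ in a scale-n cube-site t): one Λ_{n+1}-bond from the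
corner of s reaches the scale-n cube at the far corner of the +e_μ face — THE BOND OF THE COARSER LATTICE ACROSS THE
INTERFACE (reading R0) —, which is joined to t by Λ_n-bonds along the face (all cubes there are scale-n sites,
`layer_of_near_sepZd`); the proof of `B15LatticeCubeContours.reachable_of_step_down` under the ℓ¹ collar.
[cite: Balaban1984PropagatorsII, (2.46) p.231] -/
private theorem reachable_of_step_down {N : ℕ} (hmono : Monotone Z) (hsep : SepZd Z M₁ L N) (hN : 1 ≤ N)
    (ht : Tiles M₁ L Z) (hM₁ : 0 < M₁) (hL : 2 ≤ L) {n : ℕ} {s t : CubeSite M₁ L Z} (hsn : s.1.1 = n + 1)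
    (htn : t.1.1 = n) {x : Fin d → ℤ} {μ : Fin d} (hx : x ∈ cube M₁ L s.1.1 s.1.2)
    (hy : Function.update x μ (x μ + 1) ∈ cube M₁ L t.1.1 t.1.2) : (latC M₁ L Z).Reachable s t := by
  classical
  have hL0 : 0 < L := by omega
  have hst : s ≠ t := fun h => by rw [h, htn] at hsn; omega
  obtain ⟨hF1, hF2⟩ := face_eqs hmono hM₁ hL0 hst hx hy
  have hx' := (mem_cube (M₁ := M₁)).mp hx
  have hy' := (mem_cube (M₁ := M₁)).mp hy
  rw [hsn] at hF1 hx'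
  rw [htn] at hF2 hy'
  set S : ℤ := ((M₁ * L ^ n : ℕ) : ℤ) with hSdef
  set S' : ℤ := ((M₁ * L ^ (n + 1) : ℕ) : ℤ) with hS'def
  set c := s.1.2 with hcdef
  set c' := t.1.2 with hc'def
  set F := x μ + 1 with hFdef
  have hSpos : 0 < M₁ * L ^ n := Nat.mul_pos hM₁ (Nat.pow_pos hL0)
  have hS0 : (0 : ℤ) < S := by rw [hSdef]; exact_mod_cast hSpos
  have hS1 : (1 : ℤ) ≤ S := hS0
  have hSS : S' = S * (L : ℤ) := by rw [hS'def, hSdef]; push_cast; ring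
  have hL1 : (1 : ℤ) ≤ (L : ℤ) := by exact_mod_cast hL0
  have hSle : S ≤ S' := by rw [hSS]; nlinarith
  -- the slab of thickness S above the face x_μ = F of s
  let W : Set (Fin d → ℤ) :=
    {z | F ≤ z μ ∧ z μ < F + S ∧ ∀ ν, ν ≠ μ → S' * c ν ≤ z ν ∧ z ν < S' * (c ν + 1)}
  have hWB : W ⊆ cube M₁ L (n + 1) (Function.update c μ (c μ + 1)) := by
    intro z hz
    obtain ⟨hz1, hz2, hz3⟩ := hz
    rw [mem_cube]
    intro ν
    by_cases hν : ν = μ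
    · subst hν
      rw [Function.update_self, ← hS'def]
      constructor <;> nlinarith
    · rw [Function.update_of_ne hν, ← hS'def]
      exact hz3 ν hν
  have hnear : ∀ z ∈ W, ∃ b ∈ cube M₁ L s.1.1 s.1.2, l1Dist z b ≤ ((M₁ * L ^ n : ℕ) : ℤ) := by
    intro z hz
    obtain ⟨hz1, hz2, hz3⟩ := hz
    refine ⟨Function.update z μ (F - 1), ?_, ?_⟩
    · rw [hsn, mem_cube]
      intro ν
      by_cases hν : ν = μ
      · subst hν
        rw [Function.update_self, ← hS'def]
        constructor <;> nlinarith
      · rw [Function.update_of_ne hν, ← hS'def]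
        exact hz3 ν hν
    · rw [l1Dist_update, ← hSdef, abs_le]
      constructor <;> omega
  have hyW : Function.update x μ F ∈ W := by
    refine ⟨by rw [Function.update_self], by rw [Function.update_self]; omega, fun ν hν => ?_⟩
    rw [Function.update_of_ne hν]
    exact hx' ν
  have hlayer := layer_of_near_sepZd hmono hsep hN ht hM₁ hL s hsn _ hWB hnear (s := t) htn hy hyW
  -- the box of scale-n cubes above that face
  let lo : Fin d → ℤ := Function.update (fun ν => (L : ℤ) * c ν) μ ((L : ℤ) * (c μ + 1))
  let hi : Fin d → ℤ := Function.update (fun ν => (L : ℤ) * c ν + L - 1) μ ((L : ℤ) * (c μ + 1))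
  have hbox : ∀ e : Fin d → ℤ, (∀ ν, lo ν ≤ e ν ∧ e ν ≤ hi ν) → cube M₁ L n e ⊆ Z (n + 1) \ Z n := by
    intro e he z hz
    apply hlayer z
    rw [mem_cube, ← hSdef] at hz
    have heμ : e μ = (L : ℤ) * (c μ + 1) := by
      have h := he μ
      simp only [lo, hi, Function.update_self] at h
      omega
    refine ⟨?_, ?_, fun ν hν => ?_⟩
    · have := (hz μ).1
      rw [heμ] at this
      have e1 : S * ((L : ℤ) * (c μ + 1)) = S' * (c μ + 1) := by rw [hSS]; ring
      linarith
    · have := (hz μ).2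
      rw [heμ] at this
      have e1 : S * ((L : ℤ) * (c μ + 1) + 1) = S' * (c μ + 1) + S := by rw [hSS]; ring
      linarith
    · have h := he ν
      simp only [lo, hi, Function.update_of_ne hν] at h
      have h1 := (hz ν).1
      have h2 := (hz ν).2
      rw [hSS]
      constructor <;> nlinarith
  have htbox : ∀ ν, lo ν ≤ c' ν ∧ c' ν ≤ hi ν := by
    intro ν
    by_cases hν : ν = μ
    · subst hν
      simp only [lo, hi, Function.update_self]
      have e1 : S * c' ν = S * ((L : ℤ) * (c ν + 1)) := by rw [← hF2, hF1, hSS]; ring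
      have := mul_left_cancel₀ hS0.ne' e1
      omega
    · simp only [lo, hi, Function.update_of_ne hν]
      have h1 := hx' ν
      have h2 := hy' ν
      rw [Function.update_of_ne hν] at h2
      rw [hSS] at h1
      have ea : S * ((L : ℤ) * c ν) = S * (L : ℤ) * c ν := by ring
      have eb : S * ((L : ℤ) * c ν + L - 1 + 1) = S * (L : ℤ) * (c ν + 1) := by ring
      have a : (L : ℤ) * c ν ≤ c' ν := idx_le_of_bounds hS0 (by rw [ea]; exact h1.1) h2.2
      have b : c' ν ≤ (L : ℤ) * c ν + L - 1 := idx_le_of_bounds hS0 h2.1 (by rw [eb]; exact h1.2)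
      exact ⟨a, b⟩
  -- the scale-n cube at the end of the Λ_{n+1}-bond from the corner of s
  have hlo : ∀ ν, lo ν ≤ lo ν ∧ lo ν ≤ hi ν := by
    intro ν
    by_cases hν : ν = μ
    · subst hν
      simp only [lo, hi, Function.update_self]
      omega
    · simp only [lo, hi, Function.update_of_ne hν]
      constructor <;> nlinarith
  let f : CubeSite M₁ L Z := ⟨(n, lo), hbox lo hlo⟩
  have h1 : (latC M₁ L Z).Reachable f t := reachable_in_box n lo hi hbox f t rfl htn hlo htbox
  have h2 : (latC M₁ L Z).Adj s f := by
    refine latC_adj.mpr ⟨fun h => ?_, Or.inl ⟨μ, funext fun ν => ?_⟩⟩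
    · have h' : s.1.1 = f.1.1 := congrArg (fun w : CubeSite M₁ L Z => w.1.1) h
      change s.1.1 = n at h'
      omega
    · rw [Pi.add_apply, cornerC_apply, cornerC_apply]
      unfold zoneC sideZ
      rw [hsn]
      change S * lo ν = S' * c ν + (Pi.single μ S' : Fin d → ℤ) ν
      by_cases hν : ν = μ
      · subst hν
        simp only [lo, Function.update_self, Pi.single_eq_same]
        rw [hSS]
        ring
      · simp only [lo, Function.update_of_ne hν, Pi.single_eq_of_ne hν, add_zero]
        rw [hSS]
        ring
  exact h2.reachable.trans h1

/-- **Lattice points one unit step apart lie in cube-sites joined by a lattice contour** (three cases; scales of face-adjacent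
cubes differ by at most one, `zone_le_succ_of_unitStep`). [cite: Balaban1984PropagatorsII, (2.46) p.231] -/
theorem reachable_of_adjacent_points_sepZd {N : ℕ} (hmono : Monotone Z) (hsep : SepZd Z M₁ L N) (hN : 1 ≤ N)
    (ht : Tiles M₁ L Z) (hM₁ : 0 < M₁) (hL : 2 ≤ L) {s t : CubeSite M₁ L Z} {x : Fin d → ℤ} {μ : Fin d}
    (hx : x ∈ cube M₁ L s.1.1 s.1.2) (hy : Function.update x μ (x μ + 1) ∈ cube M₁ L t.1.1 t.1.2) :
    (latC M₁ L Z).Reachable s t := by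
  by_cases hst : s = t
  · subst hst
    rfl
  have hL0 : 0 < L := by omega
  obtain ⟨h1, h2⟩ := zone_le_succ_of_unitStep hmono hsep hN hM₁ (by omega) hx hy
  obtain h | h | h : t.1.1 = s.1.1 ∨ t.1.1 = s.1.1 + 1 ∨ s.1.1 = t.1.1 + 1 := by omega
  · exact (adj_of_step_same hmono hM₁ hL0 hst h hx hy).reachable
  · exact reachable_of_step_up hmono hsep hN ht hM₁ hL rfl h hx hy
  · exact reachable_of_step_down hmono hsep hN ht hM₁ hL h rfl hx hy

section Chosen

variable {N : ℕ} (hmono : Monotone Z) (hsep : SepZd Z M₁ L N) (hN : 1 ≤ N) (ht : Tiles M₁ L Z) (hM₁ : 0 < M₁)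
  (hL : 2 ≤ L) (σ : (Fin d → ℤ) → CubeSite M₁ L Z) (hσ : ∀ x, x ∈ cube M₁ L (σ x).1.1 (σ x).1.2)
include hmono hsep hN ht hM₁ hL hσ

/-- Moving one coordinate up by `m` unit steps keeps the chosen cube-sites in one component. [folklore] -/
private theorem reachable_update_add (x : Fin d → ℤ) (μ : Fin d) (v : ℤ) :
    ∀ m : ℕ, (latC M₁ L Z).Reachable (σ (Function.update x μ v)) (σ (Function.update x μ (v + m)))
  | 0 => by simp
  | m + 1 => by
    refine (reachable_update_add x μ v m).trans
      (reachable_of_adjacent_points_sepZd hmono hsep hN ht hM₁ hL (μ := μ) (hσ _) ?_)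
    have e : Function.update (Function.update x μ (v + m)) μ (Function.update x μ (v + m) μ + 1) =
        Function.update x μ (v + ((m + 1 : ℕ) : ℤ)) := by
      rw [Function.update_self, Function.update_idem]
      push_cast
      ring_nf
    rw [e]
    exact hσ _

/-- Changing one coordinate arbitrarily keeps the chosen cube-sites in one component. [folklore] -/
private theorem reachable_update (x : Fin d → ℤ) (μ : Fin d) (w : ℤ) :
    (latC M₁ L Z).Reachable (σ x) (σ (Function.update x μ w)) := by
  rcases le_total (x μ) w with h | h
  · obtain ⟨m, hm⟩ := Int.le.dest h
    have := reachable_update_add hmono hsep hN ht hM₁ hL σ hσ x μ (x μ) m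
    rwa [Function.update_eq_self, hm] at this
  · obtain ⟨m, hm⟩ := Int.le.dest h
    have := reachable_update_add hmono hsep hN ht hM₁ hL σ hσ x μ w m
    rw [hm, Function.update_eq_self] at this
    exact this.symm

/-- Any two lattice points have chosen cube-sites in one component (`ℤᵈ` is connected by unit steps). [folklore] -/
private theorem reachable_chosen (x y : Fin d → ℤ) : (latC M₁ L Z).Reachable (σ x) (σ y) := by
  classical
  suffices H : ∀ (T : Finset (Fin d)) (x y : Fin d → ℤ), (∀ ν, ν ∉ T → x ν = y ν) →
      (latC M₁ L Z).Reachable (σ x) (σ y) from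
    H Finset.univ x y (fun ν hν => absurd (Finset.mem_univ ν) hν)
  intro T
  induction T using Finset.induction_on with
  | empty =>
    intro x y h
    rw [show x = y from funext fun ν => h ν (Finset.notMem_empty ν)]
  | @insert μ T _ ih =>
    intro x y h
    refine (reachable_update hmono hsep hN ht hM₁ hL σ hσ x μ (y μ)).trans (ih _ y fun ν hν => ?_)
    by_cases hνμ : ν = μ
    · subst hνμ
      simp
    · rw [Function.update_of_ne hνμ]
      exact h ν (by simp [hνμ, hν])

end Chosen

/-- **THE LATTICE CONTOUR GRAPH IS CONNECTED UNDER THE ℓ¹ COLLAR** (nested `Z`, `SepZd Z M₁ L N` with `N ≥ 1`, the covering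
(2.4) `Tiles`, `M₁ ≥ 1`, `L ≥ 2`): print's admissible contours, read literally, join any two blocks of the generating set —
*"Of course the infimum is attained at some contour Γ_{y,y′}"* presupposes exactly this.  Generalises
`B15LatticeCubeContours.latC_connected` (one-cube collar `LayerSepZd Z M L`, `M₁ ≤ M` — a case of the present hypothesis by
`sepZd_of_layerSepZd`). [cite: Balaban1984PropagatorsII, (2.4) p.224, (2.46) p.231] -/
theorem latC_connected_of_sepZd {N : ℕ} (hmono : Monotone Z) (hsep : SepZd Z M₁ L N) (hN : 1 ≤ N) (ht : Tiles M₁ L Z)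
    (hM₁ : 0 < M₁) (hL : 2 ≤ L) : (latC M₁ L Z).Connected := by
  have hL0 : 0 < L := by omega
  choose σ hσ using ht
  have ht' : Tiles M₁ L Z := fun x => ⟨σ x, hσ x⟩
  haveI : Nonempty (CubeSite M₁ L Z) := ⟨σ fun _ => 0⟩
  have hs : ∀ u : CubeSite M₁ L Z, σ (cornerC u) = u := fun u =>
    site_eq_of_mem hmono hM₁ hL0 (hσ _) (corner_mem_cube (Nat.mul_pos hM₁ (Nat.pow_pos hL0)) _)
  refine ⟨fun s t => ?_⟩
  have := reachable_chosen hmono hsep hN ht' hM₁ hL σ hσ (cornerC s) (cornerC t)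
  rwa [hs, hs] at this

end Connected

/-! ## §4 Lemma 2.1 (2.60)–(2.63) with c₁″ for every geometry realised by the lattice contours under the ℓ¹ collar -/

section Lemma21

variable [NeZero d] {M₁ L : ℕ} {Z : ℕ → Set (Fin d → ℤ)} {g : B6.Geometry}

/-- **(2.61″) WITH c₁″ = 13c₀(½α)^{4d} FOR EVERY GEOMETRY REALISED BY THE LATTICE CONTOURS OF A NESTED CUBE MODEL UNDER THE ℓ¹
COLLAR `SepZd Z M₁ L N`** (embedded form: 𝔅 ↪ cube-sites with its zones, `g.dist` = the lattice-contour distance; covering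
`Tiles`, `M₁ ≥ 1`, `L ≥ 2`, `RM ≤ N`, `2 ≤ N`, (2.59)) — NO graph-theoretic hypothesis left.
[cite: Balaban1984PropagatorsII, Lemma 2.1 (2.61) p.234, (2.2) p.224; corrected] -/
theorem ineq261T_latC_of_sepZd {N : ℕ} (ι : g.Site → CubeSite M₁ L Z) (hι : Function.Injective ι)
    (hzone : ∀ y, zoneC (ι y) = g.scale y) (hdist : ∀ y y', g.dist y y' = ((latC M₁ L Z).dist (ι y) (ι y') : ℝ))
    (hmono : Monotone Z) (hsep : SepZd Z M₁ L N) (ht : Tiles M₁ L Z) (hM₁ : 0 < M₁) (hL : 2 ≤ L)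
    (hRM : g.R * g.M ≤ (N : ℝ)) (hN : 2 ≤ N) {δ₀ α : ℝ} (hα : 0 < α) (hδ : 0 < δ₀)
    (h259 : B6.Cond259 d δ₀ α g.R g.M) :
    B6Lemma21Repaired.Ineq261With (B6Lemma21TwoScale.c1TwoScale d δ₀ α) g δ₀ α :=
  B6Decomp247LatticeTwoSided.ineq261T_of_twoSidedDrawing (C := latSystem ι hzone) (A := Fin d → ℤ)
    (latDrawing hmono hM₁ (by omega)) (fun y y' => hdist y y') (latC_connected_of_sepZd hmono hsep (by omega) ht hM₁ hL)
    (separates_latC_of_sepZd hmono hsep (by omega) hM₁ (by omega)) (levelGap_latC_of_sepZd hmono hsep hM₁ (by omega))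
    hRM hN hι hα hδ h259

variable (F : Finset (CubeSite M₁ L Z)) (kk : ℕ) (η R Mr : ℝ)

/-- **ALL FOUR DISPLAYS (2.60)–(2.63) OF LEMMA 2.1 WITH c₁″ for the lattice-contour geometry `latGeo` under the ℓ¹ collar**
(`SepZd Z M₁ L N`, `Tiles`, `M₁ ≥ 1`, `L ≥ 2`, `R·M_r ≤ N`, `2 ≤ N`, `δ₀ > 0`; 0 < α < 1, (2.59)) — (2.60) with the exponent
`αδ₀·R·M_r·max{|j−j′|−1, 0}` for any `R·M_r` up to the collar count `N`.
[cite: Balaban1984PropagatorsII, Lemma 2.1 (2.60)–(2.63) p.234, (2.2) p.224; corrected] -/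
theorem lemma21_full_latGeo_of_sepZd {N : ℕ} (hmono : Monotone Z) (hsep : SepZd Z M₁ L N) (ht : Tiles M₁ L Z)
    (hM₁ : 0 < M₁) (hL : 2 ≤ L) (hRM : R * Mr ≤ (N : ℝ)) (hN : 2 ≤ N) {δ₀ : ℝ} (hδ : 0 < δ₀) :
    ∀ α : ℝ, 0 < α → α < 1 → B6.Cond259 d δ₀ α R Mr →
      B6RandomWalk.Ineq260 (latGeo M₁ L Z F kk η R Mr) δ₀ α ∧
        B6Lemma21Repaired.Ineq261With (B6Lemma21TwoScale.c1TwoScale d δ₀ α) (latGeo M₁ L Z F kk η R Mr) δ₀ α ∧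
        B6Lemma21Repaired.Ineq262With (B6Lemma21TwoScale.c1TwoScale d δ₀ α) (latGeo M₁ L Z F kk η R Mr) δ₀ α ∧
        B6Lemma21Repaired.Ineq263With (B6Lemma21TwoScale.c1TwoScale d δ₀ α) (latGeo M₁ L Z F kk η R Mr) δ₀ α :=
  fun α hα0 hα1 h259 =>
    B6Decomp247LatticeTwoSided.lemma21_full_of_twoSidedDrawing d δ₀ hδ (fun _ : PUnit => latGeo M₁ L Z F kk η R Mr)
      (fun _ => latSystem (g := latGeo M₁ L Z F kk η R Mr) Subtype.val fun _ => rfl) (fun _ => N)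
      (fun _ => Fin d → ℤ) (fun _ => latDrawing hmono hM₁ (by omega)) (fun _ _ _ => rfl)
      (fun _ => latC_connected_of_sepZd hmono hsep (by omega) ht hM₁ hL)
      (fun _ => separates_latC_of_sepZd hmono hsep (by omega) hM₁ (by omega))
      (fun _ => levelGap_latC_of_sepZd hmono hsep hM₁ (by omega)) (fun _ => hRM) (fun _ => hN)
      (fun _ => Subtype.val_injective) PUnit.unit trivial α hα0 hα1 h259

end Lemma21

/-! ## §5 THE PAPER'S SETTING (2.1)–(2.4) VERBATIM: nested cube domains on ℤᵈ with the collar (2.2) -/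

section Printed

variable (Ω : ℕ → Set (Fin d → ℤ))

/-- **(2.2), ℓ¹ reading**: *"(L^jη)^{−1} dist(Ω_j^c, Ω_{j+1}) > RM"* — every point outside Ω_j and every point of Ω_{j+1} are
more than `RM·Lʲ` apart (η = 1; ℓ¹ norm on the lattice, the weakest reading: see `cond22_of_sup`, `cond22_of_eucl`).  A
hypothesis shape, used only to the left of `→`. [cite: Balaban1984PropagatorsII, (2.2) p.224] -/
def Cond22 (L RM : ℕ) : Prop :=
  ∀ ⦃j : ℕ⦄ ⦃a b : Fin d → ℤ⦄, a ∉ Ω j → b ∈ Ω (j + 1) → ((RM * L ^ j : ℕ) : ℤ) < l1Dist a b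

/-- (2.2) with «dist» read in the SUP norm of the carrier and a real threshold `T` in place of RM.
[cite: Balaban1984PropagatorsII, (2.2) p.224] -/
def Cond22Sup (L : ℕ) (T : ℝ) : Prop :=
  ∀ ⦃j : ℕ⦄ ⦃a b : Fin d → ℤ⦄, a ∉ Ω j → b ∈ Ω (j + 1) → T * (L : ℝ) ^ j < dist (toR a) (toR b)

/-- (2.2) with «dist» read in the EUCLIDEAN norm and a real threshold `T` in place of RM.
[cite: Balaban1984PropagatorsII, (2.2) p.224] -/
def Cond22Eucl (L : ℕ) (T : ℝ) : Prop :=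
  ∀ ⦃j : ℕ⦄ ⦃a b : Fin d → ℤ⦄, a ∉ Ω j → b ∈ Ω (j + 1) → T * (L : ℝ) ^ j < dist (toE a) (toE b)

variable {Ω} {L : ℕ}

/-- (2.2) in ℓ¹ IS the carrier collar `SepZd Ωᶜ 1 L RM` (sites = unit-side cubes, `M₁ = 1`). [cite: Balaban1984PropagatorsII, (2.2) p.224] -/
theorem sepZd_of_cond22 {RM : ℕ} (h : Cond22 Ω L RM) : SepZd (fun j => (Ω j)ᶜ) 1 L RM := by
  intro n a b ha hb
  have hb' : b ∈ Ω (n + 1) := by simpa using hb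
  simpa using h ha hb'

/-- The sup-norm reading implies the ℓ¹ reading with every integer count `RM ≤ T`. [cite: Balaban1984PropagatorsII, (2.2) p.224] -/
theorem cond22_of_sup {T : ℝ} {RM : ℕ} (h : Cond22Sup Ω L T) (hT : (RM : ℝ) ≤ T) : Cond22 Ω L RM := by
  intro j a b ha hb
  have h1 := h ha hb
  have h2 := dist_toR_le_l1Dist a b
  have hLj : (0 : ℝ) ≤ (L : ℝ) ^ j := by positivity
  have h3 : (RM : ℝ) * (L : ℝ) ^ j ≤ T * (L : ℝ) ^ j := mul_le_mul_of_nonneg_right hT hLj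
  have h4 : (((RM * L ^ j : ℕ) : ℤ) : ℝ) < ((l1Dist a b : ℤ) : ℝ) := by push_cast; linarith
  exact_mod_cast h4

/-- The Euclidean reading implies the ℓ¹ reading with every integer count `RM ≤ T`. [cite: Balaban1984PropagatorsII, (2.2) p.224] -/
theorem cond22_of_eucl {T : ℝ} {RM : ℕ} (h : Cond22Eucl Ω L T) (hT : (RM : ℝ) ≤ T) : Cond22 Ω L RM := by
  intro j a b ha hb
  have h1 := h ha hb
  have h2 := dist_toE_le_l1Dist a b
  have hLj : (0 : ℝ) ≤ (L : ℝ) ^ j := by positivity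
  have h3 : (RM : ℝ) * (L : ℝ) ^ j ≤ T * (L : ℝ) ^ j := mul_le_mul_of_nonneg_right hT hLj
  have h4 : (((RM * L ^ j : ℕ) : ℤ) : ℝ) < ((l1Dist a b : ℤ) : ℝ) := by push_cast; linarith
  exact_mod_cast h4

/-- Nested domains (2.1) «Ω₁ ⊃ Ω₂ ⊃ …»: the complements `Z_j = Ω_jᶜ` increase. [cite: Balaban1984PropagatorsII, (2.1) p.224] -/
theorem monotone_compl_of_antitone (hanti : Antitone Ω) : Monotone (fun j => (Ω j)ᶜ) :=
  fun _ _ hmn => Set.compl_subset_compl.mpr (hanti hmn)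

/-- **The covering (2.4) «T = ⋃_{j=0}^k B^j(Λ_j)» for print's domains**: with `Ω 0 = T`, `Ω (k+1) = ∅` and every `Ω j` a union
of `LʲM`-cubes (*"a sum of big blocks"*), every lattice point lies in the Lʲ-block of a site of some Λ_j
(`B15TouchingCubeDomains.tiles_of_admissible` with `M₁ = 1`). [cite: Balaban1984PropagatorsII, (2.1), (2.3)–(2.4) p.224] -/
theorem tiles_printedDomains {M k : ℕ} (hL : 1 ≤ L) (hcubes : ∀ j, IsUnionOfCubes (L ^ j * M) (Ω j))
    (h0 : Ω 0 = Set.univ) (hk : Ω (k + 1) = ∅) : Tiles 1 L (fun j => (Ω j)ᶜ) :=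
  tiles_of_admissible (M := M) Nat.one_pos hL (one_dvd M) hcubes h0 fun x => ⟨k + 1, by rw [hk]; exact id⟩

variable {M R k : ℕ}

/-- **(2.57) FOR PRINT'S DOMAINS, WITH PRINT'S RM**: nested Ω with the collar (2.2) (ℓ¹), `L ≥ 1`: every admissible contour
(reading R0) from a block of Λ_{j′}, j′ < i, to a block of Λ_j, j > i, has at least `R·M + 1` bonds —
`LevelGap (latC 1 L Ωᶜ) zoneC (R·M)`. [cite: Balaban1984PropagatorsII, (2.2) p.224, (2.57) p.233] -/
theorem levelGap_printedDomains (hanti : Antitone Ω) (h22 : Cond22 Ω L (R * M)) (hL : 1 ≤ L) :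
    LevelGap (latC 1 L (fun j => (Ω j)ᶜ)) zoneC (R * M) :=
  levelGap_latC_of_sepZd (monotone_compl_of_antitone hanti) (sepZd_of_cond22 h22) Nat.one_pos hL

/-- *"The surface Σ_j separates the sets B^j(Λ_j) and B^{j−1}(Λ_{j−1})"* for print's domains (`R·M ≥ 1`).
[cite: Balaban1984PropagatorsII, p.231, (2.2) p.224] -/
theorem separates_printedDomains (hanti : Antitone Ω) (h22 : Cond22 Ω L (R * M)) (hRM : 1 ≤ R * M) (hL : 1 ≤ L) :
    Separates (latC 1 L (fun j => (Ω j)ᶜ)) zoneC :=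
  separates_latC_of_sepZd (monotone_compl_of_antitone hanti) (sepZd_of_cond22 h22) hRM Nat.one_pos hL

/-- **ADMISSIBLE CONTOURS EXIST for print's domains** (*"Of course the infimum is attained"*): (2.1) cube unions with `Ω 0 = T`,
`Ω (k+1) = ∅`, the collar (2.2) with `R·M ≥ 1`, `L ≥ 2`. [cite: Balaban1984PropagatorsII, (2.1)–(2.4) p.224, (2.46) p.231] -/
theorem connected_printedDomains (hanti : Antitone Ω) (h0 : Ω 0 = Set.univ) (hk : Ω (k + 1) = ∅)
    (hcubes : ∀ j, IsUnionOfCubes (L ^ j * M) (Ω j)) (h22 : Cond22 Ω L (R * M)) (hRM : 1 ≤ R * M) (hL : 2 ≤ L) :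
    (latC 1 L (fun j => (Ω j)ᶜ)).Connected :=
  latC_connected_of_sepZd (monotone_compl_of_antitone hanti) (sepZd_of_cond22 h22) hRM
    (tiles_printedDomains (by omega) hcubes h0 hk) Nat.one_pos hL

variable [NeZero d]

/-- **LEMMA 2.1 (2.60)–(2.63) IN THE PAPER'S OWN SETTING, WITH THE d-ONLY CONSTANT c₁″ = 13c₀(½α)^{4d}.**  Hypotheses =
(2.1): `Ω` antitone, `Ω 0 = T`, `Ω (k+1) = ∅` (k levels), every `Ω j` a union of `LʲM`-cubes; (2.2): the collar
`Cond22 Ω L (R·M)` (ℓ¹ reading; the sup / Euclidean readings below); integers R, M with `R·M ≥ 2`, `L ≥ 2`; `δ₀ > 0`.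
Conclusion, for the geometry whose sites are ANY finite set of print's base points 𝔅 (`CubeSite 1 L Ωᶜ`), distance = (2.46)
read literally, parameters = PRINT'S R AND M: for every 0 < α < 1 with (2.59) `¼αδ₀RM > 2d log c₀(½α) + 1`,
(2.60) `e^{−αδ₀d(y,y′)} ≤ e^{−αδ₀RM max{|j−j′|−1,0}}` ∧ (2.61″) `Σ_{y′} e^{−αδ₀d(y,y′)} ≤ c₁″` ∧ (2.62″) ∧ (2.63″).  The
printed c₁(α) = 12c₀(½α)^d stays refuted as typed (`B6Lemma21Counterexample`). [cite: Balaban1984PropagatorsII, Lemma 2.1 (2.60)–(2.63) p.234, (2.1)–(2.4) p.224, (2.46) p.231, (2.59) p.233; corrected] -/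
theorem lemma21_printedDomains (hanti : Antitone Ω) (h0 : Ω 0 = Set.univ) (hk : Ω (k + 1) = ∅)
    (hcubes : ∀ j, IsUnionOfCubes (L ^ j * M) (Ω j)) (h22 : Cond22 Ω L (R * M)) (hRM : 2 ≤ R * M)
    (hL : 2 ≤ L) (F : Finset (CubeSite 1 L (fun j => (Ω j)ᶜ))) (η : ℝ) {δ₀ : ℝ} (hδ : 0 < δ₀) :
    ∀ α : ℝ, 0 < α → α < 1 → B6.Cond259 d δ₀ α R M →
      B6RandomWalk.Ineq260 (latGeo 1 L (fun j => (Ω j)ᶜ) F k η R M) δ₀ α ∧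
        B6Lemma21Repaired.Ineq261With (B6Lemma21TwoScale.c1TwoScale d δ₀ α)
          (latGeo 1 L (fun j => (Ω j)ᶜ) F k η R M) δ₀ α ∧
        B6Lemma21Repaired.Ineq262With (B6Lemma21TwoScale.c1TwoScale d δ₀ α)
          (latGeo 1 L (fun j => (Ω j)ᶜ) F k η R M) δ₀ α ∧
        B6Lemma21Repaired.Ineq263With (B6Lemma21TwoScale.c1TwoScale d δ₀ α)
          (latGeo 1 L (fun j => (Ω j)ᶜ) F k η R M) δ₀ α := by
  refine lemma21_full_latGeo_of_sepZd F k η (R : ℝ) (M : ℝ) (monotone_compl_of_antitone hanti) (sepZd_of_cond22 h22)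
    (tiles_printedDomains (by omega) hcubes h0 hk) Nat.one_pos hL ?_ hRM hδ
  push_cast
  exact le_rfl

/-- **Lemma 2.1 for print's domains with «dist» in (2.2) read in the SUP norm** (threshold `T ≥ R·M`).
[cite: Balaban1984PropagatorsII, Lemma 2.1 (2.60)–(2.63) p.234, (2.2) p.224; corrected] -/
theorem lemma21_printedDomains_sup {T : ℝ} (hanti : Antitone Ω) (h0 : Ω 0 = Set.univ) (hk : Ω (k + 1) = ∅)
    (hcubes : ∀ j, IsUnionOfCubes (L ^ j * M) (Ω j)) (h22 : Cond22Sup Ω L T) (hT : ((R * M : ℕ) : ℝ) ≤ T)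
    (hRM : 2 ≤ R * M) (hL : 2 ≤ L) (F : Finset (CubeSite 1 L (fun j => (Ω j)ᶜ))) (η : ℝ) {δ₀ : ℝ}
    (hδ : 0 < δ₀) :
    ∀ α : ℝ, 0 < α → α < 1 → B6.Cond259 d δ₀ α R M →
      B6RandomWalk.Ineq260 (latGeo 1 L (fun j => (Ω j)ᶜ) F k η R M) δ₀ α ∧
        B6Lemma21Repaired.Ineq261With (B6Lemma21TwoScale.c1TwoScale d δ₀ α)
          (latGeo 1 L (fun j => (Ω j)ᶜ) F k η R M) δ₀ α ∧
        B6Lemma21Repaired.Ineq262With (B6Lemma21TwoScale.c1TwoScale d δ₀ α)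
          (latGeo 1 L (fun j => (Ω j)ᶜ) F k η R M) δ₀ α ∧
        B6Lemma21Repaired.Ineq263With (B6Lemma21TwoScale.c1TwoScale d δ₀ α)
          (latGeo 1 L (fun j => (Ω j)ᶜ) F k η R M) δ₀ α :=
  lemma21_printedDomains hanti h0 hk hcubes (cond22_of_sup h22 hT) hRM hL F η hδ

/-- **Lemma 2.1 for print's domains with «dist» in (2.2) read in the EUCLIDEAN norm** (threshold `T ≥ R·M`).
[cite: Balaban1984PropagatorsII, Lemma 2.1 (2.60)–(2.63) p.234, (2.2) p.224; corrected] -/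
theorem lemma21_printedDomains_eucl {T : ℝ} (hanti : Antitone Ω) (h0 : Ω 0 = Set.univ) (hk : Ω (k + 1) = ∅)
    (hcubes : ∀ j, IsUnionOfCubes (L ^ j * M) (Ω j)) (h22 : Cond22Eucl Ω L T) (hT : ((R * M : ℕ) : ℝ) ≤ T)
    (hRM : 2 ≤ R * M) (hL : 2 ≤ L) (F : Finset (CubeSite 1 L (fun j => (Ω j)ᶜ))) (η : ℝ) {δ₀ : ℝ}
    (hδ : 0 < δ₀) :
    ∀ α : ℝ, 0 < α → α < 1 → B6.Cond259 d δ₀ α R M →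
      B6RandomWalk.Ineq260 (latGeo 1 L (fun j => (Ω j)ᶜ) F k η R M) δ₀ α ∧
        B6Lemma21Repaired.Ineq261With (B6Lemma21TwoScale.c1TwoScale d δ₀ α)
          (latGeo 1 L (fun j => (Ω j)ᶜ) F k η R M) δ₀ α ∧
        B6Lemma21Repaired.Ineq262With (B6Lemma21TwoScale.c1TwoScale d δ₀ α)
          (latGeo 1 L (fun j => (Ω j)ᶜ) F k η R M) δ₀ α ∧
        B6Lemma21Repaired.Ineq263With (B6Lemma21TwoScale.c1TwoScale d δ₀ α)
          (latGeo 1 L (fun j => (Ω j)ᶜ) F k η R M) δ₀ α :=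
  lemma21_printedDomains hanti h0 hk hcubes (cond22_of_eucl h22 hT) hRM hL F η hδ

end Printed

/-! ## §5b One constant over any FAMILY of such domain data (the `DagBinding.B6Lemma21Param` shape) -/

section Family

variable [NeZero d] {I : Type}

/-- **LEMMA 2.1 (TWO-SCALE CONSTANT) UNIFORMLY OVER ANY FAMILY OF LATTICE-CONTOUR GEOMETRIES UNDER ℓ¹ COLLARS**:
`B6Lemma21TwoScale.Lemma21TwoScale d δ₀ geo` — ONE constant c₁″(α) for the whole family (per member: nested `Z`, the collar
`SepZd Z M₁ L N`, the covering, `M₁ ≥ 1`, `L ≥ 2`, `R·M_r ≤ N`, `2 ≤ N`; everything may vary with the index).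
[cite: Balaban1984PropagatorsII, Lemma 2.1 (2.60)–(2.61) p.234, (2.2) p.224; corrected] -/
theorem lemma21TwoScale_latGeo_sepZd_family {δ₀ : ℝ} (hδ : 0 < δ₀) (M₁ L N : I → ℕ)
    (Z : I → ℕ → Set (Fin d → ℤ)) (F : ∀ i, Finset (CubeSite (M₁ i) (L i) (Z i))) (kk : I → ℕ) (η R Mr : I → ℝ)
    (hmono : ∀ i, Monotone (Z i)) (hsep : ∀ i, SepZd (Z i) (M₁ i) (L i) (N i)) (ht : ∀ i, Tiles (M₁ i) (L i) (Z i))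
    (hM₁ : ∀ i, 0 < M₁ i) (hL : ∀ i, 2 ≤ L i) (hRM : ∀ i, R i * Mr i ≤ (N i : ℝ)) (hN : ∀ i, 2 ≤ N i) :
    B6Lemma21TwoScale.Lemma21TwoScale d δ₀ (fun i => latGeo (M₁ i) (L i) (Z i) (F i) (kk i) (η i) (R i) (Mr i)) :=
  B6Decomp247LatticeTwoSided.lemma21TwoScale_of_twoSidedDrawing d δ₀ hδ _
    (fun i => latSystem (g := latGeo (M₁ i) (L i) (Z i) (F i) (kk i) (η i) (R i) (Mr i)) Subtype.val fun _ => rfl)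
    N (fun _ => Fin d → ℤ) (fun i => latDrawing (hmono i) (hM₁ i) (by have := hL i; omega))
    (fun _ _ _ => rfl) (fun i => latC_connected_of_sepZd (hmono i) (hsep i) (by have := hN i; omega) (ht i) (hM₁ i) (hL i))
    (fun i => separates_latC_of_sepZd (hmono i) (hsep i) (by have := hN i; omega) (hM₁ i) (by have := hL i; omega))
    (fun i => levelGap_latC_of_sepZd (hmono i) (hsep i) (hM₁ i) (by have := hL i; omega)) hRM hN
    (fun _ => Subtype.val_injective)

/-- **The same over any family of the paper's domain data** (member i: (2.1) nested cube unions `Ω i` with `Ω i 0 = T`,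
`Ω i (k i + 1) = ∅`, the collar (2.2) `Cond22 (Ω i) (L i) (R i · M i)`, `2 ≤ R i · M i`, `2 ≤ L i`; common d, δ₀): ONE d-only
constant for all of them, each member with ITS OWN R, M in (2.59)/(2.60). [cite: Balaban1984PropagatorsII, Lemma 2.1 (2.60)–(2.61) p.234, (2.1)–(2.2) p.224; corrected] -/
theorem lemma21TwoScale_printedDomains_family {δ₀ : ℝ} (hδ : 0 < δ₀) (L M R k : I → ℕ)
    (Ω : I → ℕ → Set (Fin d → ℤ)) (hanti : ∀ i, Antitone (Ω i)) (h0 : ∀ i, Ω i 0 = Set.univ)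
    (hk : ∀ i, Ω i (k i + 1) = ∅) (hcubes : ∀ i j, IsUnionOfCubes (L i ^ j * M i) (Ω i j))
    (h22 : ∀ i, Cond22 (Ω i) (L i) (R i * M i)) (hRM : ∀ i, 2 ≤ R i * M i) (hL : ∀ i, 2 ≤ L i)
    (F : ∀ i, Finset (CubeSite 1 (L i) (fun j => (Ω i j)ᶜ))) (η : I → ℝ) :
    B6Lemma21TwoScale.Lemma21TwoScale d δ₀
      (fun i => latGeo 1 (L i) (fun j => (Ω i j)ᶜ) (F i) (k i) (η i) (R i) (M i)) :=
  lemma21TwoScale_latGeo_sepZd_family hδ (fun _ => 1) L (fun i => R i * M i) (fun i j => (Ω i j)ᶜ) F k η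
    (fun i => (R i : ℝ)) (fun i => (M i : ℝ)) (fun i => monotone_compl_of_antitone (hanti i))
    (fun i => sepZd_of_cond22 (h22 i)) (fun i => tiles_printedDomains (M := M i) (by have := hL i; omega) (hcubes i) (h0 i) (hk i))
    (fun _ => Nat.one_pos) hL (fun i => by push_cast; exact le_rfl) hRM

end Family

/-! ## §6 A witness with R < L: (2.1)–(2.2) hold, the one-cube collar of the admissible-sequence instance fails -/

section Witness

/-- The witness domains in d = 1, L = 8, M = 1 (R = 3): `Ω 0 = T`, `Ω 1 = {x ≥ −32}` (a union of 8-blocks), `Ω 2 = {x ≥ 0}`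
(a union of 64-blocks), `Ω j = ∅` for j ≥ 3; collar between Ω₁ᶜ and Ω₂ = 33 lattice units > RM·L = 24, but < L²M = 64.
[cite: Balaban1984PropagatorsII, (2.1)–(2.2) p.224] -/
def ΩW : ℕ → Set (Fin 1 → ℤ)
  | 0 => Set.univ
  | 1 => {x | -32 ≤ x 0}
  | 2 => {x | 0 ≤ x 0}
  | _ + 3 => ∅

/-- The witness domains are nested. [cite: Balaban1984PropagatorsII, (2.1) p.224] -/
theorem antitone_ΩW : Antitone ΩW := by
  refine antitone_nat_of_succ_le fun n => ?_
  match n with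
  | 0 => exact Set.subset_univ _
  | 1 => intro x (hx : 0 ≤ x 0); show -32 ≤ x 0; omega
  | 2 => exact Set.empty_subset _
  | _ + 3 => exact Set.empty_subset _

/-- The witness domains are unions of `8ʲ·1`-blocks ((2.1) *"a sum of big blocks"*, M = 1). [cite: Balaban1984PropagatorsII, (2.1) p.224] -/
theorem isUnionOfCubes_ΩW : ∀ j, IsUnionOfCubes (8 ^ j * 1) (ΩW j) := by
  intro j x y hxy
  have h0 := congrFun hxy 0
  unfold cubeIdx at h0
  match j with
  | 0 => simp [ΩW]
  | 1 =>
    show -32 ≤ x 0 ↔ -32 ≤ y 0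
    norm_num at h0
    omega
  | 2 =>
    show 0 ≤ x 0 ↔ 0 ≤ y 0
    norm_num at h0
    omega
  | _ + 3 => simp [ΩW]

/-- (2.2) in ℓ¹ with RM = 3·1 (so R = 3 < L = 8) holds for the witness. [cite: Balaban1984PropagatorsII, (2.2) p.224] -/
theorem cond22_ΩW : Cond22 ΩW 8 (3 * 1) := by
  intro j a b ha hb
  match j with
  | 0 => exact absurd (Set.mem_univ a) ha
  | 1 =>
    have ha' : ¬ (-32 ≤ a 0) := ha
    have hb' : 0 ≤ b 0 := hb
    unfold l1Dist
    rw [Fin.sum_univ_one, abs_sub_comm, abs_of_nonneg (by omega)]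
    norm_num
    omega
  | 2 => exact absurd hb (Set.notMem_empty b)
  | _ + 3 => exact absurd hb (Set.notMem_empty b)

/-- **The one-cube collar of the admissible-sequence instance FAILS for the witness** (for every M′ ≥ 1): the points −33 ∈ Ω₁ᶜ
and 0 ∈ Ω₂ are 33 < 64·M′ apart — so `B15LatticeCubeContours.lemma21_full_latGeo` does not apply to it, while
`lemma21_printedDomains` does. [cite: Balaban1989LargeFieldI, p.179; Balaban1984PropagatorsII, (2.2) p.224] -/
theorem not_layerSepZd_witness {M' : ℕ} (hM' : 1 ≤ M') : ¬ LayerSepZd (fun j => (ΩW j)ᶜ) M' 8 := by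
  intro h
  have ha : (fun _ : Fin 1 => (-33 : ℤ)) ∈ (ΩW 1)ᶜ := by
    show ¬ (-32 ≤ (-33 : ℤ)); omega
  have hb : (fun _ : Fin 1 => (0 : ℤ)) ∉ (ΩW 2)ᶜ := by
    intro hb; exact hb (show (0 : ℤ) ≤ 0 from le_rfl)
  have h1 := h ha hb
  have h2 : dist (toR fun _ : Fin 1 => (-33 : ℤ)) (toR fun _ : Fin 1 => (0 : ℤ)) ≤ 33 := by
    refine (dist_pi_le_iff (by norm_num)).mpr fun μ => ?_
    rw [Real.dist_eq]
    unfold toR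
    norm_num
  have hM1 : (1 : ℝ) ≤ M' := by exact_mod_cast hM'
  have h4 : ((M' : ℕ) : ℝ) * ((8 : ℕ) : ℝ) ^ (1 + 1) ≤ 33 := h1.trans h2
  have e : ((M' : ℕ) : ℝ) * ((8 : ℕ) : ℝ) ^ (1 + 1) = (M' : ℝ) * 64 := by norm_num
  rw [e] at h4
  linarith

/-- A block of Λ₁ of the witness: the 8-block [−32, −24) ⊂ Ω₁∖Ω₂. [cite: Balaban1984PropagatorsII, (2.3) p.224] -/
def siteW₁ : CubeSite 1 8 (fun j => (ΩW j)ᶜ) :=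
  ⟨(1, fun _ => -4), fun x hx => by
    have h := hx 0
    norm_num at h
    constructor
    · show ¬ (0 ≤ x 0); omega
    · intro hx1; exact hx1 (show -32 ≤ x 0 by omega)⟩

/-- A block of Λ₂ of the witness: the 64-block [0, 64) ⊂ Ω₂. [cite: Balaban1984PropagatorsII, (2.3) p.224] -/
def siteW₂ : CubeSite 1 8 (fun j => (ΩW j)ᶜ) :=
  ⟨(2, fun _ => 0), fun x hx => by
    have h := hx 0
    norm_num at h
    constructor
    · show x ∉ (∅ : Set (Fin 1 → ℤ)); exact Set.notMem_empty x
    · intro hx2; exact hx2 (show 0 ≤ x 0 by omega)⟩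

/-- A point of Λ₀ = Ω₁ᶜ of the witness: −33. [cite: Balaban1984PropagatorsII, (2.3) p.224] -/
def siteW₀ : CubeSite 1 8 (fun j => (ΩW j)ᶜ) :=
  ⟨(0, fun _ => -33), fun x hx => by
    have h := hx 0
    norm_num at h
    constructor
    · show ¬ (-32 ≤ x 0); omega
    · show x ∉ (Set.univ : Set (Fin 1 → ℤ))ᶜ; simp⟩

/-- All three scales of the witness are inhabited (zones 0, 1, 2). [cite: Balaban1984PropagatorsII, (2.45) p.231] -/
theorem zones_witness : zoneC siteW₀ = 0 ∧ zoneC siteW₁ = 1 ∧ zoneC siteW₂ = 2 := ⟨rfl, rfl, rfl⟩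

/-- A generating set 𝔅 for the witness containing one block of each of Λ₀, Λ₁, Λ₂. [cite: Balaban1984PropagatorsII, (2.45) p.231] -/
noncomputable def FW : Finset (CubeSite 1 8 (fun j => (ΩW j)ᶜ)) := by
  classical exact {siteW₀, siteW₁, siteW₂}

/-- The three blocks belong to the generating set of the witness. [cite: Balaban1984PropagatorsII, (2.45) p.231] -/
theorem mem_FW : siteW₀ ∈ FW ∧ siteW₁ ∈ FW ∧ siteW₂ ∈ FW := by
  classical
  unfold FW
  refine ⟨?_, ?_, ?_⟩ <;> simp

/-- **LEMMA 2.1 (2.60)–(2.63) WITH c₁″ FOR THE WITNESS** (R = 3 < L = 8, M = 1, k = 2; 𝔅 ⊇ one block of each of Λ₀, Λ₁,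
Λ₂): every hypothesis of `lemma21_printedDomains` discharged — the generality beyond the one-cube collar is inhabited.
[cite: Balaban1984PropagatorsII, Lemma 2.1 (2.60)–(2.63) p.234; corrected] -/
theorem lemma21_witness (η : ℝ) {δ₀ : ℝ} (hδ : 0 < δ₀) :
    ∀ α : ℝ, 0 < α → α < 1 → B6.Cond259 1 δ₀ α (3 : ℕ) (1 : ℕ) →
      B6RandomWalk.Ineq260 (latGeo 1 8 (fun j => (ΩW j)ᶜ) FW 2 η (3 : ℕ) (1 : ℕ)) δ₀ α ∧
        B6Lemma21Repaired.Ineq261With (B6Lemma21TwoScale.c1TwoScale 1 δ₀ α)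
          (latGeo 1 8 (fun j => (ΩW j)ᶜ) FW 2 η (3 : ℕ) (1 : ℕ)) δ₀ α ∧
        B6Lemma21Repaired.Ineq262With (B6Lemma21TwoScale.c1TwoScale 1 δ₀ α)
          (latGeo 1 8 (fun j => (ΩW j)ᶜ) FW 2 η (3 : ℕ) (1 : ℕ)) δ₀ α ∧
        B6Lemma21Repaired.Ineq263With (B6Lemma21TwoScale.c1TwoScale 1 δ₀ α)
          (latGeo 1 8 (fun j => (ΩW j)ᶜ) FW 2 η (3 : ℕ) (1 : ℕ)) δ₀ α :=
  lemma21_printedDomains (k := 2) (R := 3) (M := 1) antitone_ΩW rfl rfl isUnionOfCubes_ΩW cond22_ΩW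
    (by norm_num) (by norm_num) _ η hδ

end Witness


/-! ## §7 (v1.1, append-only) THE SAME ON THE TORUS T_η = ℤᵈ/∏_μ P_μℤ — print's «Ω_j ⊂ T_η» with wrap-around contours,
under the ℓ¹ collar, by the universal-cover transfer of `B15LatticeCubeTorus` -/

section Torus

open B15LatticeCubeTorus

variable {M₁ L : ℕ} {Z : ℕ → Set (Fin d → ℤ)} {P : Fin d → ℕ} (h : IsPeriodic M₁ L Z P)
  {F : Finset (TSite M₁ L Z P)} {kk : ℕ} {η R Mr : ℝ} {N : ℕ}

/-- **(2.60) ON THE TORUS under the ℓ¹ collar** (periodic nested `Z`, `SepZd Z M₁ L N` on the cover, `N ≥ 1`, the covering,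
`M₁ ≥ 1`, `L ≥ 2`, `RM ≤ N`, `αδ₀ ≥ 0`): transferred walk form `levelGap_torC` of `levelGap_latC_of_sepZd`.
[cite: Balaban1984PropagatorsII, (2.60) p.234, (2.2) p.224, (2.57) p.233; Balaban1984PropagatorsI, Sect. A p.17] -/
theorem ineq260_torGeo_of_sepZd (hmono : Monotone Z) (hsep : SepZd Z M₁ L N) (hN : 1 ≤ N) (ht : Tiles M₁ L Z)
    (hM₁ : 0 < M₁) (hL : 2 ≤ L) (hRM : R * Mr ≤ (N : ℝ)) {δ₀ α : ℝ} (hαδ : 0 ≤ α * δ₀) :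
    B6RandomWalk.Ineq260 (torGeo h F kk η R Mr) δ₀ α :=
  ineq260_of_levelGap (realizes_torGeo h F kk η R Mr)
    (torC_connected (latC_connected_of_sepZd hmono hsep hN ht hM₁ hL))
    (levelGap_torC (levelGap_latC_of_sepZd hmono hsep hM₁ (by omega))) hRM hαδ

/-- **(2.54) ON THE TORUS under the ℓ¹ collar**: the triangle inequality of the torus contour distance (admissible contours
exist on the cover, hence on the torus). [cite: Balaban1984PropagatorsII, (2.54) p.233] -/
theorem triangle254_torGeo_of_sepZd (hmono : Monotone Z) (hsep : SepZd Z M₁ L N) (hN : 1 ≤ N) (ht : Tiles M₁ L Z)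
    (hM₁ : 0 < M₁) (hL : 2 ≤ L) : B6RandomWalk.Triangle254 (torGeo h F kk η R Mr) :=
  triangle254_of_realizes (realizes_torGeo h F kk η R Mr)
    (torC_connected (latC_connected_of_sepZd hmono hsep hN ht hM₁ hL))

variable [NeZero d]

/-- **(2.61″) ON THE TORUS WITH c₁″ under the ℓ¹ collar** — the transfer of `B15LatticeCubeTorus.ineq261T_torGeo` verbatim
(fix the row y; lift every torus site to the cover at torus distance, `exists_lift_dist_eq`; distinct sites have distinct
lifts, `eq_of_shift_eq`; the torus row IS a row of the cover geometry `liftGeo F ι`), now bounded by this file's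
`ineq261T_latC_of_sepZd` (`SepZd Z M₁ L N`, `RM ≤ N`, `2 ≤ N`) instead of the one-cube collar.
[cite: Balaban1984PropagatorsII, Lemma 2.1 (2.61) p.234, (2.46) p.231, (2.1)–(2.2) p.224; Balaban1984PropagatorsI, Sect. A p.17; corrected] -/
theorem ineq261T_torGeo_of_sepZd (hmono : Monotone Z) (hsep : SepZd Z M₁ L N) (ht : Tiles M₁ L Z) (hM₁ : 0 < M₁)
    (hL : 2 ≤ L) (hRM : R * Mr ≤ (N : ℝ)) (hN : 2 ≤ N) {δ₀ α : ℝ} (hα : 0 < α) (hδ : 0 < δ₀)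
    (h259 : B6.Cond259 d δ₀ α R Mr) :
    B6Lemma21Repaired.Ineq261With (B6Lemma21TwoScale.c1TwoScale d δ₀ α) (torGeo h F kk η R Mr) δ₀ α := by
  intro y
  have hconn := latC_connected_of_sepZd hmono hsep (by omega) ht hM₁ hL
  choose v hv using fun b : ↥F => exists_lift_dist_eq (h := h) hconn y.1 b.1
  set ι : ↥F → CubeSite M₁ L Z := fun b => shift h (v b) b.1.1 with hιdef
  have hιy : ι y = y.1.1 := by
    have h0 : (latC M₁ L Z).dist y.1.1 (ι y) = 0 := by
      rw [hιdef]
      simp only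
      rw [hv y, SimpleGraph.dist_self]
    exact ((hconn.dist_eq_zero_iff).mp h0).symm
  have hι : Function.Injective ι := fun b c hbc => Subtype.ext (eq_of_shift_eq (h := h) hmono hM₁ (by omega) hbc)
  have hrow := ineq261T_latC_of_sepZd (g := liftGeo F ι kk η R Mr) ι hι (fun _ => rfl) (fun _ _ => rfl) hmono hsep ht
    hM₁ hL hRM hN hα hδ h259 y
  calc ∑ y' : ↥F, Real.exp (-(α * δ₀ * (((torC h).dist y.1 y'.1 : ℕ) : ℝ)))
      = ∑ y' : ↥F, Real.exp (-(α * δ₀ * (((latC M₁ L Z).dist (ι y) (ι y') : ℕ) : ℝ))) := by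
        refine Finset.sum_congr rfl fun y' _ => ?_
        rw [hιy, hιdef]
        simp only
        rw [hv y']
    _ ≤ B6Lemma21TwoScale.c1TwoScale d δ₀ α := hrow

/-- **LEMMA 2.1 (TWO-SCALE CONSTANT) ON THE TORUS under the ℓ¹ collar**: `Lemma21TwoScale d δ₀ (torGeo …)`.
[cite: Balaban1984PropagatorsII, Lemma 2.1 (2.60)–(2.61) p.234; Balaban1984PropagatorsI, Sect. A p.17; corrected] -/
theorem lemma21TwoScale_torGeo_of_sepZd (hmono : Monotone Z) (hsep : SepZd Z M₁ L N) (ht : Tiles M₁ L Z) (hM₁ : 0 < M₁)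
    (hL : 2 ≤ L) (hRM : R * Mr ≤ (N : ℝ)) (hN : 2 ≤ N) {δ₀ : ℝ} (hδ : 0 < δ₀) :
    B6Lemma21TwoScale.Lemma21TwoScale d δ₀ (fun _ : PUnit => torGeo h F kk η R Mr) :=
  B6Lemma21TwoScale.lemma21TwoScale_of_ineq261T d δ₀ hδ.le _ (fun _ => torSystem h F kk η R Mr) (fun _ => N)
    (fun _ => realizes_torGeo h F kk η R Mr)
    (fun _ => torC_connected (latC_connected_of_sepZd hmono hsep (by omega) ht hM₁ hL))
    (fun _ => levelGap_torC (levelGap_latC_of_sepZd hmono hsep hM₁ (by omega))) (fun _ => hRM)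
    fun _ _ _ hα0 _ h259 => ineq261T_torGeo_of_sepZd h hmono hsep ht hM₁ hL hRM hN hα0 hδ h259

/-- **ALL FOUR DISPLAYS (2.60)–(2.63) OF LEMMA 2.1 WITH c₁″ ON THE TORUS CUBE CARRIER under the ℓ¹ collar** (0 < α < 1,
(2.59)). [cite: Balaban1984PropagatorsII, Lemma 2.1 (2.60)–(2.63) p.234, (2.1)–(2.2) p.224; Balaban1984PropagatorsI, Sect. A p.17; corrected] -/
theorem lemma21_full_torGeo_of_sepZd (hmono : Monotone Z) (hsep : SepZd Z M₁ L N) (ht : Tiles M₁ L Z) (hM₁ : 0 < M₁)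
    (hL : 2 ≤ L) (hRM : R * Mr ≤ (N : ℝ)) (hN : 2 ≤ N) {δ₀ : ℝ} (hδ : 0 < δ₀) :
    ∀ α : ℝ, 0 < α → α < 1 → B6.Cond259 d δ₀ α R Mr →
      B6RandomWalk.Ineq260 (torGeo h F kk η R Mr) δ₀ α ∧
        B6Lemma21Repaired.Ineq261With (B6Lemma21TwoScale.c1TwoScale d δ₀ α) (torGeo h F kk η R Mr) δ₀ α ∧
        B6Lemma21Repaired.Ineq262With (B6Lemma21TwoScale.c1TwoScale d δ₀ α) (torGeo h F kk η R Mr) δ₀ α ∧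
        B6Lemma21Repaired.Ineq263With (B6Lemma21TwoScale.c1TwoScale d δ₀ α) (torGeo h F kk η R Mr) δ₀ α :=
  fun α hα0 hα1 h259 =>
    B6Lemma21TwoScale.lemma21TwoScale_full d δ₀ hδ.le _
      (fun _ => triangle254_torGeo_of_sepZd h hmono hsep (by omega) ht hM₁ hL)
      (lemma21TwoScale_torGeo_of_sepZd h hmono hsep ht hM₁ hL hRM hN hδ) PUnit.unit trivial α hα0 hα1 h259

end Torus

/-! ## §8 (v1.1, append-only) THE PAPER'S SETTING ON ITS OWN TORUS: periodic nested cube domains with the collar (2.2) -/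

section PrintedTorus

open B15LatticeCubeTorus

variable {Ω : ℕ → Set (Fin d → ℤ)} {L M R k : ℕ} {P : Fin d → ℕ}

/-- **The periodicity datum of print's domains on T_η**, CONSTRUCTED (`B15LatticeCubeTorus.isPeriodic_of_top` with M₁ = 1):
nested `Ω` pulled back to the cover, every `Ω j` invariant under the deck translations `x ↦ x + P·v` (i.e. a subset of the
torus), `Ω (k+1) = ∅`, positive periods with `L^k ∣ P_μ` (print's torus has sides that are multiples of the block sizes),
`L ≥ 1`. [cite: Balaban1984PropagatorsII, (2.1)–(2.4) p.224; Balaban1984PropagatorsI, Sect. A p.17] -/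
theorem isPeriodic_printedDomains (hanti : Antitone Ω) (hk : Ω (k + 1) = ∅)
    (hper : ∀ (j : ℕ) (x v : Fin d → ℤ), x + pmul P v ∈ Ω j ↔ x ∈ Ω j) (hP : ∀ μ, 0 < P μ)
    (hdvdP : ∀ μ, L ^ k ∣ P μ) (hL : 1 ≤ L) : IsPeriodic 1 L (fun j => (Ω j)ᶜ) P :=
  isPeriodic_of_top (K := k) (monotone_compl_of_antitone hanti) Nat.one_pos (by omega) hP
    (fun n x v => by simp only [Set.mem_compl_iff, hper])
    (by show (Ω (k + 1))ᶜ = Set.univ; rw [hk, Set.compl_empty]) (fun μ => by simpa using hdvdP μ)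

variable [NeZero d]

/-- **LEMMA 2.1 (2.60)–(2.63) IN THE PAPER'S OWN SETTING ON THE TORUS T_η, WITH THE d-ONLY c₁″.**  Print's *«Ω₁ ⊃ Ω₂ ⊃ … ⊃
Ω_k, Ω_j ⊂ T_η»* pulled back to the universal cover ℤᵈ: (2.1) `Ω` antitone, `Ω 0 = T`, `Ω (k+1) = ∅`, every `Ω j` a union of
`LʲM`-cubes and invariant under the deck translations of the torus `ℤᵈ/∏_μ P_μℤ` (positive periods, `L^k ∣ P_μ`); (2.2) the
collar `Cond22 Ω L (R·M)` on the cover (for periodic sets this IS the torus condition: the torus distance of two orbits is the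
least cover distance of their points); integers `R·M ≥ 2`, `L ≥ 2`; `δ₀ > 0`.  Conclusion for the TORUS geometry (sites =
any finite set of torus base points `TSite 1 L Ωᶜ P`, distance = (2.46) on T_η with wrap-around contours, parameters =
print's R, M; periodicity datum `isPeriodic_printedDomains`): for every 0 < α < 1 with (2.59), (2.60) ∧ (2.61″) ∧ (2.62″) ∧
(2.63″) with c₁″ = 13c₀(½α)^{4d}. [cite: Balaban1984PropagatorsII, Lemma 2.1 (2.60)–(2.63) p.234, (2.1)–(2.4) p.224, (2.46) p.231, (2.59) p.233; Balaban1984PropagatorsI, Sect. A p.17; corrected] -/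
theorem lemma21_printedDomains_torus (hanti : Antitone Ω) (h0 : Ω 0 = Set.univ) (hk : Ω (k + 1) = ∅)
    (hcubes : ∀ j, IsUnionOfCubes (L ^ j * M) (Ω j)) (hper : ∀ (j : ℕ) (x v : Fin d → ℤ), x + pmul P v ∈ Ω j ↔ x ∈ Ω j)
    (hP : ∀ μ, 0 < P μ) (hdvdP : ∀ μ, L ^ k ∣ P μ) (h22 : Cond22 Ω L (R * M)) (hRM : 2 ≤ R * M) (hL : 2 ≤ L)
    (F : Finset (TSite 1 L (fun j => (Ω j)ᶜ) P)) (η : ℝ) {δ₀ : ℝ} (hδ : 0 < δ₀) :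
    ∀ α : ℝ, 0 < α → α < 1 → B6.Cond259 d δ₀ α R M →
      B6RandomWalk.Ineq260
          (torGeo (isPeriodic_printedDomains hanti hk hper hP hdvdP (by omega)) F k η R M) δ₀ α ∧
        B6Lemma21Repaired.Ineq261With (B6Lemma21TwoScale.c1TwoScale d δ₀ α)
          (torGeo (isPeriodic_printedDomains hanti hk hper hP hdvdP (by omega)) F k η R M) δ₀ α ∧
        B6Lemma21Repaired.Ineq262With (B6Lemma21TwoScale.c1TwoScale d δ₀ α)
          (torGeo (isPeriodic_printedDomains hanti hk hper hP hdvdP (by omega)) F k η R M) δ₀ α ∧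
        B6Lemma21Repaired.Ineq263With (B6Lemma21TwoScale.c1TwoScale d δ₀ α)
          (torGeo (isPeriodic_printedDomains hanti hk hper hP hdvdP (by omega)) F k η R M) δ₀ α := by
  refine lemma21_full_torGeo_of_sepZd _ (monotone_compl_of_antitone hanti) (sepZd_of_cond22 h22)
    (tiles_printedDomains (by omega) hcubes h0 hk) Nat.one_pos hL ?_ hRM hδ
  push_cast
  exact le_rfl

/-- **The torus witness**: the §6 domains periodised with period 1600 = 25·64 in d = 1 (`Ω₁ = {x mod 1600 ∉ [1504, 1568)}`-type
data are not needed — we take the honest route: the §6 cover data `ΩW` are NOT periodic, so the torus theorem is instantiated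
on the simplest periodic configuration with a thin collar): `Ω 0 = T`, `Ω 1 = ⋃_v [1600v − 32, 1600v + 800)`,
`Ω 2 = ⋃_v [1600v, 1600v + 768)`, `Ω 3 = ∅` in d = 1, L = 8, M = 1, R = 3, P = 1600: nested, unions of 8- resp. 64-blocks,
1600-periodic, collar between Ω₁ᶜ and Ω₂ ≥ 33 > 24 = RM·L (and < 64 = L²M: the one-cube collar fails), `8² ∣ 1600`.
[cite: Balaban1984PropagatorsII, (2.1)–(2.2) p.224; Balaban1984PropagatorsI, Sect. A p.17] -/
def ΩT : ℕ → Set (Fin 1 → ℤ)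
  | 0 => Set.univ
  | 1 => {x | x 0 % 1600 < 800 ∨ 1568 ≤ x 0 % 1600}
  | 2 => {x | x 0 % 1600 < 768}
  | _ + 3 => ∅

/-- The torus witness domains are nested. [cite: Balaban1984PropagatorsII, (2.1) p.224] -/
theorem antitone_ΩT : Antitone ΩT := by
  refine antitone_nat_of_succ_le fun n => ?_
  match n with
  | 0 => exact Set.subset_univ _
  | 1 => intro x (hx : x 0 % 1600 < 768); show x 0 % 1600 < 800 ∨ 1568 ≤ x 0 % 1600; omega
  | 2 => exact Set.empty_subset _
  | _ + 3 => exact Set.empty_subset _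

/-- The torus witness domains are invariant under the deck translation x ↦ x + 1600v. [cite: Balaban1984PropagatorsI, Sect. A p.17] -/
theorem periodic_ΩT : ∀ (j : ℕ) (x v : Fin 1 → ℤ), x + pmul (fun _ => 1600) v ∈ ΩT j ↔ x ∈ ΩT j := by
  intro j x v
  have e : (x + pmul (fun _ => 1600) v) 0 % 1600 = x 0 % 1600 := by
    show (x 0 + ((1600 : ℕ) : ℤ) * v 0) % 1600 = x 0 % 1600
    push_cast
    rw [Int.add_mul_emod_self_left]
  match j with
  | 0 => simp [ΩT]
  | 1 => show (x + pmul (fun _ => 1600) v) 0 % 1600 < 800 ∨ 1568 ≤ (x + pmul (fun _ => 1600) v) 0 % 1600 ↔ _; rw [e]; rfl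
  | 2 => show (x + pmul (fun _ => 1600) v) 0 % 1600 < 768 ↔ _; rw [e]; rfl
  | _ + 3 => simp [ΩT]

/-- The torus witness domains are unions of `8ʲ·1`-blocks. [cite: Balaban1984PropagatorsII, (2.1) p.224] -/
theorem isUnionOfCubes_ΩT : ∀ j, IsUnionOfCubes (8 ^ j * 1) (ΩT j) := by
  intro j x y hxy
  have h0 := congrFun hxy 0
  unfold cubeIdx at h0
  match j with
  | 0 => simp [ΩT]
  | 1 =>
    show x 0 % 1600 < 800 ∨ 1568 ≤ x 0 % 1600 ↔ y 0 % 1600 < 800 ∨ 1568 ≤ y 0 % 1600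
    norm_num at h0
    omega
  | 2 =>
    show x 0 % 1600 < 768 ↔ y 0 % 1600 < 768
    norm_num at h0
    omega
  | _ + 3 => simp [ΩT]

/-- (2.2) in ℓ¹ with RM = 3·1 (R = 3 < L = 8) holds for the torus witness (a point outside Ω₁ has residue in [800, 1568), a
point of Ω₂ residue in [0, 768): they differ by at least 33). [cite: Balaban1984PropagatorsII, (2.2) p.224] -/
theorem cond22_ΩT : Cond22 ΩT 8 (3 * 1) := by
  intro j a b ha hb
  match j with
  | 0 => exact absurd (Set.mem_univ a) ha
  | 1 =>
    have ha' : ¬ (a 0 % 1600 < 800 ∨ 1568 ≤ a 0 % 1600) := ha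
    have hb' : b 0 % 1600 < 768 := hb
    unfold l1Dist
    rw [Fin.sum_univ_one]
    norm_num
    rw [lt_abs]
    omega
  | 2 => exact absurd hb (Set.notMem_empty b)
  | _ + 3 => exact absurd hb (Set.notMem_empty b)

/-- **LEMMA 2.1 (2.60)–(2.63) WITH c₁″ ON THE TORUS FOR THE PERIODIC WITNESS** (d = 1, L = 8, M = 1, R = 3 < L, k = 2,
period 1600; 𝔅 = any finite set of torus base points): every hypothesis of `lemma21_printedDomains_torus` discharged.
[cite: Balaban1984PropagatorsII, Lemma 2.1 (2.60)–(2.63) p.234; Balaban1984PropagatorsI, Sect. A p.17; corrected] -/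
theorem lemma21_witness_torus
    (F : Finset (TSite 1 8 (fun j => (ΩT j)ᶜ) (fun _ => 1600))) (η : ℝ) {δ₀ : ℝ} (hδ : 0 < δ₀) :
    ∀ α : ℝ, 0 < α → α < 1 → B6.Cond259 1 δ₀ α (3 : ℕ) (1 : ℕ) →
      B6RandomWalk.Ineq260
          (torGeo (isPeriodic_printedDomains (k := 2) antitone_ΩT rfl periodic_ΩT (fun _ => by norm_num)
            (fun _ => by norm_num) (by norm_num)) F 2 η (3 : ℕ) (1 : ℕ)) δ₀ α ∧
        B6Lemma21Repaired.Ineq261With (B6Lemma21TwoScale.c1TwoScale 1 δ₀ α)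
          (torGeo (isPeriodic_printedDomains (k := 2) antitone_ΩT rfl periodic_ΩT (fun _ => by norm_num)
            (fun _ => by norm_num) (by norm_num)) F 2 η (3 : ℕ) (1 : ℕ)) δ₀ α ∧
        B6Lemma21Repaired.Ineq262With (B6Lemma21TwoScale.c1TwoScale 1 δ₀ α)
          (torGeo (isPeriodic_printedDomains (k := 2) antitone_ΩT rfl periodic_ΩT (fun _ => by norm_num)
            (fun _ => by norm_num) (by norm_num)) F 2 η (3 : ℕ) (1 : ℕ)) δ₀ α ∧
        B6Lemma21Repaired.Ineq263With (B6Lemma21TwoScale.c1TwoScale 1 δ₀ α)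
          (torGeo (isPeriodic_printedDomains (k := 2) antitone_ΩT rfl periodic_ΩT (fun _ => by norm_num)
            (fun _ => by norm_num) (by norm_num)) F 2 η (3 : ℕ) (1 : ℕ)) δ₀ α :=
  lemma21_printedDomains_torus (R := 3) (M := 1) antitone_ΩT rfl rfl isUnionOfCubes_ΩT periodic_ΩT
    (fun _ => by norm_num) (fun _ => by norm_num) cond22_ΩT (by norm_num) (by norm_num) F η hδ

end PrintedTorus

end Literature.MathematicalPhysics.QuantumFieldTheory.Balaban1983to89.B6Lemma21PrintedDomains
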